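import Mathlib
import Literature.Barriers.PneNP.TSPExtensionComplexityHyperplaneBound
import Literature.Combinatorics.Optimization.ZeroOnePolytopesHighPsdRank
import Literature.Combinatorics.Optimization.GenericPolytopePsdRankLowerBound
import Literature.Barriers.PneNP.ExtendedFormulationYannakakisConverse
import HarnessLib

/-!
# Integral polygons with high extension complexity (Fiorini–Rothvoß–Tiwary 2012, Theorem 8; Briët–Dadush–Pokutta 2015, Theorem 8)

Source: S. Fiorini, T. Rothvoß, H. R. Tiwary, *Extended formulations for polygons*, Discrete
Comput. Geom. 48 (2012) 658–668 = arXiv:1107.0371 [FioriniRothvossTiwary2012]; held text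
`paper:arxiv-1107.0371` ("pNN" = its 3000-character chunks). Companion of
`GenericPolytopePsdRankLowerBound.lean` (their Thm. 3: generic convex `n`-gons have `xc ≥ √(2n)`).

Printed statements (verbatim). §5 (p08): "The pair `T, U` is said to be normalized if
`‖T^ℓ‖_∞ = ‖U_ℓ‖_∞` for every `ℓ ∈ [r]` … we can always scale the rows and columns of two matrices
so that they are normalized without changing `TU`." Lemma 4 (Rothvoß): "If the pair `T, U` is
normalized, then `max{‖T‖_∞, ‖U‖_∞} ≤ √‖TU‖_∞`." Lemma 5: "For `d, N ≥ 2` let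
`V = {v_1,…,v_n} ⊆ ℤ^d` be a convex independent and non-empty set of points with `‖v_i‖_∞ ≤ N` for
`i ∈ [n]`. Let `P := conv(V)` and let `X := P ∩ ℤ^d`. Denote `r := xc(P)` and `Δ := ((d+1)N)^d`.
Then there are matrices `Ā ∈ ℤ^{(d+r)×d}`, `T̄ ∈ ((1/(4r(d+r)Δ)) ℤ₊)^{(d+r)×r}` and a vector
`b̄ ∈ ℤ^{d+r}` with `‖Ā‖_∞, ‖b̄‖_∞, ‖T̄‖_∞ ≤ Δ` such that
`X = {x ∈ ℤ^d | ∃ y ∈ [0,Δ]^r : ‖Āx + T̄y − b̄‖_∞ ≤ 1/(4(d+r))}`."  Its proof (p08–p09): Yannakakis'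
theorem (Thm. 1); "Choose `I ⊆ {1,…,m}` of size `|I| = k` such that the volume of the parallelepiped
spanned by the vectors `{(A_i, T_i) | i ∈ I}` … is maximized. Let `T'_I` be the matrix obtained from
rounding the coefficients of `T_I` to the nearest multiple of `1/(4r(d+r)Δ)`"; Claim 6 `X ⊆ Y`
(triangle inequality); Claim 7 `X ⊇ Y`: "Since `A, b` and `x` are integral, one even has
`A_ℓ x ≥ b_ℓ + 1` … by Cramer's rule `|λ_i| ≤ 1` … `‖A_I x − b_I + T'_I y‖_∞ ≥ 1/(d+r) − 1/(4(d+r)) >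
1/(4(d+r))`."  **Theorem 8** (p09): "For every `n ≥ 3`, there exists a convex `n`-gon `P` with
vertices in `[2n] × [4n²]` and `xc(P) = Ω(√n/√(log n))`."  Proof (p09): "The `2n` points of the set
`Z := {(z, z²) | z ∈ [2n]}` are obviously convex independent. In other words, every subset `X ⊆ Z`
of size `|X| = n` yields a different convex `n`-gon. The number of such `n`-gons is
`C(2n, n) ≥ 2ⁿ`. Let `R := max{xc(conv(X)) | X ⊆ Z, |X| = n}` … the map `Φ` must be injective … the
number of such systems is bounded by `(cn^{11})^{(3+R)·(2+R)} ≤ 2^{c' log n · R²}` … We conclude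
that `2^{c' log₂ n · R²} ≥ 2ⁿ` and thus `R = Ω(√n/√(log n))`."

What this file PROVES (namespace `Literature.Combinatorics.Optimization`, helpers in
`IntegralPolygonXC`; EFs = the tree's slack-form `Literature.Barriers.PneNP.HasEFOfSize C r`,
`C = {x | ∃ y ≥ 0, Ex + Fy = g}` with `r` sign-constrained variables, whose least `r` is `xc(C)`;
the grid point `z : Fin N` is `(a_z, a_z²)` with `a_z = z + 1 ∈ [N]`):
* `IntegralPolygonXC.exists_code_decode_eq` — Lemma 5 for the grid polygons: if
  `conv{(a_z, a_z²) : z ∈ V}` (`∅ ≠ V ⊆ [N]`) has an EF of size `r`, then a code — `≤ r + 4` chords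
  of the grid parabola with rounded nonnegative rows `T'` on the grid `η ℤ`,
  `η = 1/(2(r+1)(r+4))` — decodes (tolerance `1/(4(r+4))`, certificates `y ∈ [0,1]^{r+1}`) to
  exactly `V`;
* `IntegralPolygonXC.le_log_mul_sq_of_forall`, `IntegralPolygonXC.exists_forall_not_hasEFOfSize` —
  the count: if every `n`-subset of `[2n]` spans a polygon with an EF of size `R` (`n ≥ 2`,
  `1 ≤ R ≤ n`) then `n ≤ 102 ⌊log₂ n⌋ R²` (codes `≤ 2^{200 ⌊log₂ n⌋ R²}`, subsets
  `C(2n, n) ≥ 4ⁿ/(2n)`);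
* `IntegralPolygonXC.exists_ngon_le_log_mul_sq` — Theorem 8 in explicit form: for every `n ≥ 2`
  some `n`-subset of the grid spans a polygon ALL of whose EFs have size `k` with
  `n ≤ 102 ⌊log₂ n⌋ k²`;
* `IntegralPolygonXC.pt_mem_extremePoints` — grid points are in convex position (each is exposed by
  `2 a_z x₁ − x₂`);
* `FioriniRothvossTiwary2012_thm8` — the printed Theorem 8, `Ω` read as `∃ c > 0 ∃ n₀ ∀ n ≥ n₀`
  (here `c = 1/13`, `n₀ = 2`), the `n`-gon given as an injective family of `n` extreme points
  `(z, z²)`, `z ∈ [2n]`.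

Proof = the printed one (Lemma 4 normalisation, Lemma 5 rounding with the volume-maximising
subsystem and Claims 6–7, counting), written after the tree's typing of Rothvoß's 0/1 original
(`ZeroOnePolytopesHighPsdRank.lean`, namespace `ZeroOneLpEF`, whose parameters `dimBound 2 r = r + 4`,
`gridInv 2 r = 2(r+1)(r+4)`, `tol 2 r = 1/(4(r+4))`, rounding `roundZ` and certificates
`Admissible` we reuse with `d = 2`), with these recorded DEVIATIONS:
1. (chords instead of facets) Lemma 5 starts from a non-redundant integral facet description with
   `‖A‖_∞, ‖b‖_∞ ≤ Δ` ([HindrySilverman]); its proof only uses that the system is integral, valid on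
   `P`, and violated by `≥ 1` at every candidate point outside. On the parabola grid this holds for
   the system of all chord inequalities `±(x₂ − (a_i + a_j) x₁ + a_i a_j) ≥ 0` through pairs of grid
   points that are valid on `V` (`exists_valid_violated`: a grid point `z ∉ V` violates the chord
   through its two neighbours in `V`, or through the two extreme vertices, by the nonzero integer
   `|(z − i)(z − j)| ≥ 1`); entries `≤ 2N`, right-hand sides and slacks `≤ N²` — polynomial in `n`,
   as printed.
2. (grid decoding) the printed `Y` ranges over `ℤ²`; injectivity of `X ↦ Φ(X)` only needs decoding
   on the candidate set `Z`, so `decode` tests grid points only (it returns `Y ∩ Z = X`).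
3. (Yannakakis with `r + 1` columns) as in `ZeroOneLpEF`: the tree's duality-based
   `HasEFOfSize.exists_nonneg_factorization` carries an extra constant column, immaterial for the
   count; the normalisation is to `0 ≤ U ≤ 1`, `0 ≤ T ≤ ‖S‖_∞ ≤ N²` instead of `√‖S‖_∞` twice.
4. (subsystem on `(A_i, b_i, T_i)` jointly) the volume-maximising subsystem is taken in
   `ℝ² × ℝ × ℝ^{r+1}` (`ZeroOneSdpLift.exists_subfamily_coeff_le_one`, `|I| ≤ r + 4`), so that
   `Σ λ_i b_i = b_ℓ` needs no separate argument.
5. (bookkeeping) `C(2n, n) ≥ 4ⁿ/(2n)` (Mathlib's `Nat.four_pow_le_two_mul_self_mul_centralBinom`);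
   EFs of size `0` are impossible for a set with two points (`not_hasEFOfSize_zero`) and sizes
   `k > n` satisfy the bound trivially, so the maximum `R` "(note that `R ≤ n`)" is replaced by a
   largest `R ≤ n` failing the count (`Nat.findGreatest`).

Part II (namespace `IntegralPolygonPsd`, theorem `BrietDadushPokutta2014_thm8`) proves the
SEMIDEFINITE analogue — Briët–Dadush–Pokutta, Math. Program. 153 (2015), Theorem 8: `d`-gons with
vertices in `[2d] × [4d²]` and `xc_SDP = Ω((d/log d)^{1/4})` — on the same grid; see its header.
Part III records the "most polygons" counts (`card_le_of_forall_hasEFOfSize`,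
`card_le_of_forall_hasPsdLift`) and both theorems in slack-matrix language
(`FioriniRothvossTiwary2012_thm8_nonnegRank` via Yannakakis' theorem, the tree's
`hasEFOfSize_of_complete_nonneg_factorization`; `BrietDadushPokutta2014_thm8_slack` via FGPRT
Thm. 3.3 = `FawziEtAl2015_thm33_holds`).
-/

noncomputable section

open Set Finset Matrix

namespace Literature.Combinatorics.Optimization

namespace IntegralPolygonXC

open Literature.Barriers.PneNP (HasEFOfSize)

variable {N : ℕ}

/-! ### The grid polygons: vertices on the parabola `(z, z²)`, `z ∈ [N]` -/

/-- The abscissa `a_z = z + 1 ∈ [N]` of the `z`-th grid point. [cite: FioriniRothvossTiwary2012, Thm. 8 (p09)] -/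
def absc (z : Fin N) : ℝ := (z : ℝ) + 1

/-- The parabola point `(a_z, a_z²) ∈ [N] × [N²]`. [cite: FioriniRothvossTiwary2012, Thm. 8 (p09, the set Z)] -/
def pt (z : Fin N) : Fin 2 → ℝ := ![absc z, absc z ^ 2]

/-- Row data `(i, j, up)`: the chord inequality through the parabola points `i`, `j`, in its lower
(`up = false`: `x₂ ≥ (a_i + a_j) x₁ − a_i a_j`) or upper (`up = true`: `x₂ ≤ (a_i + a_j) x₁ − a_i a_j`)
orientation (the printed integral facet system `Ax ≥ b` of `P`, here all chords of the grid parabola). [cite: FioriniRothvossTiwary2012, Lemma 5 (p08)] -/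
abbrev Row (N : ℕ) : Type := Fin N × Fin N × Bool

/-- Normal vector of a chord inequality `c ⬝ x ≤ d` (integer entries of size `≤ 2N`). [cite: FioriniRothvossTiwary2012, Lemma 5 (p08: "`A`, `b` integral")] -/
def cvec (ρ : Row N) : Fin 2 → ℝ :=
  if ρ.2.2 then ![-(absc ρ.1 + absc ρ.2.1), 1] else ![absc ρ.1 + absc ρ.2.1, -1]

/-- Right-hand side of a chord inequality (an integer of size `≤ N²`). [cite: FioriniRothvossTiwary2012, Lemma 5 (p08)] -/
def dval (ρ : Row N) : ℝ := if ρ.2.2 then -(absc ρ.1 * absc ρ.2.1) else absc ρ.1 * absc ρ.2.1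

/-- The sign `−1` (upper) / `+1` (lower) of a chord inequality. [cite: FioriniRothvossTiwary2012, Lemma 5 (p08)] -/
def rowSign (b : Bool) : ℤ := if b then -1 else 1

/-- The integer slack `d − c ⬝ (a_z, a_z²) = ±(z − i)(z − j)` of a chord inequality at a parabola
point (the printed slack matrix entry `S_{ij} = b_i − A_i v_j`, here an integer). [cite: FioriniRothvossTiwary2012, §2 (p04) and Lemma 5 (p08)] -/
def islack (ρ : Row N) (z : Fin N) : ℤ := rowSign ρ.2.2 * (((z : ℤ) - ρ.1) * ((z : ℤ) - ρ.2.1))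

/-- The slack of a chord inequality at a parabola point is the integer `±(z − i)(z − j)`. [folklore] -/
private theorem slack_eq (ρ : Row N) (z : Fin N) : dval ρ - cvec ρ ⬝ᵥ pt z = (islack ρ z : ℝ) := by
  rcases ρ with ⟨i, j, b⟩
  cases b <;>
    simp [dval, cvec, pt, islack, rowSign, absc, dotProduct, Fin.sum_univ_two, Matrix.cons_val_zero,
      Matrix.cons_val_one] <;> ring

/-- `|±(z − i)(z − j)| ≤ N²`. [folklore] -/
private theorem abs_islack_le (ρ : Row N) (z : Fin N) : |islack ρ z| ≤ (N : ℤ) ^ 2 := by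
  have hb : ∀ (a b : Fin N), |((a : ℤ) - b)| ≤ N := fun a b => by
    rw [abs_le]
    constructor <;> linarith [a.2, b.2, a.1.zero_le, b.1.zero_le, (show ((a : ℕ) : ℤ) < N from by exact_mod_cast a.2),
      (show ((b : ℕ) : ℤ) < N from by exact_mod_cast b.2), (show (0 : ℤ) ≤ (a : ℕ) from by positivity),
      (show (0 : ℤ) ≤ (b : ℕ) from by positivity)]
  have hs : |rowSign ρ.2.2| = 1 := by unfold rowSign; split_ifs <;> simp
  rw [islack, abs_mul, abs_mul, hs, one_mul, sq]
  exact mul_le_mul (hb _ _) (hb _ _) (abs_nonneg _) (by positivity)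

/-- A chord inequality is VALID for the vertex set `V` if it holds at every vertex. [cite: FioriniRothvossTiwary2012, Lemma 5 (p08: "`P = {x ∈ ℝ² | Ax ≥ b}`")] -/
def Valid (V : Finset (Fin N)) (ρ : Row N) : Prop := ∀ z ∈ V, 0 ≤ islack ρ z

/-- A valid inequality holds at the vertices. [folklore] -/
private theorem dot_le_of_valid {V : Finset (Fin N)} {ρ : Row N} (h : Valid V ρ) {z : Fin N} (hz : z ∈ V) :
    cvec ρ ⬝ᵥ pt z ≤ dval ρ := by
  have h1 := slack_eq ρ z
  have h2 : (0 : ℝ) ≤ islack ρ z := by exact_mod_cast h z hz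
  linarith

/-- A valid inequality holds on the whole polygon `conv{(a_z, a_z²) : z ∈ V}`. [folklore] -/
private theorem dot_le_of_valid_of_mem_convexHull {V : Finset (Fin N)} {ρ : Row N} (h : Valid V ρ)
    {x : Fin 2 → ℝ} (hx : x ∈ convexHull ℝ (pt '' (V : Set (Fin N)))) : cvec ρ ⬝ᵥ x ≤ dval ρ := by
  have hconv : Convex ℝ {w : Fin 2 → ℝ | cvec ρ ⬝ᵥ w ≤ dval ρ} :=
    convex_halfSpace_le ⟨fun a b => dotProduct_add _ a b, fun c a => dotProduct_smul c _ a⟩ _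
  refine convexHull_min ?_ hconv hx
  rintro _ ⟨z, hz, rfl⟩
  exact dot_le_of_valid h hz

/-- The slack of a valid inequality at a vertex lies in `[0, N²]`. [folklore] -/
private theorem slack_bounds {V : Finset (Fin N)} {ρ : Row N} (h : Valid V ρ) {z : Fin N} (hz : z ∈ V) :
    0 ≤ dval ρ - cvec ρ ⬝ᵥ pt z ∧ dval ρ - cvec ρ ⬝ᵥ pt z ≤ (N : ℝ) ^ 2 := by
  rw [slack_eq]
  refine ⟨by exact_mod_cast h z hz, ?_⟩
  have := (abs_le.1 (abs_islack_le ρ z)).2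
  exact_mod_cast this

/-- **Separation of non-vertices by a valid chord, with integer gap.** If `z ∉ V ≠ ∅` then some
chord inequality valid on `V` is violated at `(a_z, a_z²)` by at least `1`: the chord through the
extreme vertices if `z` is outside their range, otherwise the chord through the two vertices adjacent
to `z` (strict convexity of the parabola; integrality of all data). [cite: FioriniRothvossTiwary2012, Lemma 5 / Claim 7 (p09: "`A_ℓ x ≥ b_ℓ + 1`")] -/
theorem exists_valid_violated {V : Finset (Fin N)} (hV : V.Nonempty) {z : Fin N} (hz : z ∉ V) :
    ∃ ρ : Row N, Valid V ρ ∧ islack ρ z ≤ -1 := by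
  classical
  set m₁ : Fin N := V.min' hV with hm₁
  set m₂ : Fin N := V.max' hV with hm₂
  have hm₁le : ∀ v ∈ V, (m₁ : ℤ) ≤ (v : ℤ) := fun v hv => by exact_mod_cast V.min'_le v hv
  have hm₂ge : ∀ v ∈ V, (v : ℤ) ≤ (m₂ : ℤ) := fun v hv => by exact_mod_cast V.le_max' v hv
  by_cases hlo : z < m₁
  · refine ⟨(m₁, m₂, true), fun v hv => ?_, ?_⟩
    · simp only [islack, rowSign, if_true]
      nlinarith [hm₁le v hv, hm₂ge v hv]
    · simp only [islack, rowSign, if_true]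
      have h1 : (z : ℤ) + 1 ≤ m₁ := by exact_mod_cast hlo
      have h2 : (m₁ : ℤ) ≤ m₂ := hm₁le m₂ (V.max'_mem hV)
      nlinarith
  by_cases hhi : m₂ < z
  · refine ⟨(m₁, m₂, true), fun v hv => ?_, ?_⟩
    · simp only [islack, rowSign, if_true]
      nlinarith [hm₁le v hv, hm₂ge v hv]
    · simp only [islack, rowSign, if_true]
      have h1 : (m₂ : ℤ) + 1 ≤ z := by exact_mod_cast hhi
      have h2 : (m₁ : ℤ) ≤ m₂ := hm₁le m₂ (V.max'_mem hV)
      nlinarith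
  -- `m₁ < z < m₂`
  have hm₁z : m₁ < z := lt_of_le_of_ne (not_lt.1 hlo) fun h => hz (h ▸ V.min'_mem hV)
  have hzm₂ : z < m₂ := lt_of_le_of_ne (not_lt.1 hhi) fun h => hz (h.symm ▸ V.max'_mem hV)
  set L : Finset (Fin N) := V.filter (· < z) with hL
  set R : Finset (Fin N) := V.filter (z < ·) with hR
  have hLne : L.Nonempty := ⟨m₁, by rw [hL, mem_filter]; exact ⟨V.min'_mem hV, hm₁z⟩⟩
  have hRne : R.Nonempty := ⟨m₂, by rw [hR, mem_filter]; exact ⟨V.max'_mem hV, hzm₂⟩⟩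
  set i : Fin N := L.max' hLne with hi
  set j : Fin N := R.min' hRne with hj
  have hiz : i < z := (mem_filter.1 (L.max'_mem hLne)).2
  have hzj : z < j := (mem_filter.1 (R.min'_mem hRne)).2
  refine ⟨(i, j, false), fun v hv => ?_, ?_⟩
  · simp only [islack, rowSign, Bool.false_eq_true, if_false, one_mul]
    rcases lt_trichotomy v z with hvz | hvz | hvz
    · have hvi : v ≤ i := L.le_max' v (by rw [hL, mem_filter]; exact ⟨hv, hvz⟩)
      have h1 : (v : ℤ) ≤ i := by exact_mod_cast hvi
      have h2 : (v : ℤ) + 1 ≤ j := by exact_mod_cast (lt_trans hvz hzj)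
      nlinarith
    · exact absurd hv (hvz ▸ hz)
    · have hvj : j ≤ v := R.min'_le v (by rw [hR, mem_filter]; exact ⟨hv, hvz⟩)
      have h1 : (j : ℤ) ≤ v := by exact_mod_cast hvj
      have h2 : (i : ℤ) + 1 ≤ v := by exact_mod_cast (lt_trans hiz hvz)
      nlinarith
  · simp only [islack, rowSign, Bool.false_eq_true, if_false, one_mul]
    have h1 : (i : ℤ) + 1 ≤ z := by exact_mod_cast hiz
    have h2 : (z : ℤ) + 1 ≤ j := by exact_mod_cast hzj
    nlinarith

/-! ### Normalised nonnegative factors of the slacks (Yannakakis + Lemma 4) -/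

/-- The valid chord inequalities of `V` (the rows of the system). [cite: FioriniRothvossTiwary2012, Lemma 5 (p08)] -/
abbrev VRow (V : Finset (Fin N)) : Type := {ρ : Row N // Valid V ρ}

/-- **Normalised nonnegative factors.** If `conv{(a_z, a_z²) : z ∈ V}` has a slack-form extended
formulation with `r` inequalities, then the slacks of the valid chord inequalities at the vertices
factor as `d − c ⬝ v = Σ_i U(i) T_v(i)` over `r + 1` coordinates with `0 ≤ T ≤ 1` and
`0 ≤ U ≤ N²` (Yannakakis' theorem, the tree's `HasEFOfSize.exists_nonneg_factorization`, then the
column rescaling of Lemma 4: "the pair `T, U` is normalized …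
`max{‖T‖_∞, ‖U‖_∞} ≤ √‖TU‖_∞`", here to `‖T‖_∞ ≤ 1`, `‖U‖_∞ ≤ ‖S‖_∞ ≤ N²`).
[cite: FioriniRothvossTiwary2012, Lemma 4 and Lemma 5 proof (p08–p09)] -/
theorem exists_bounded_factors (V : Finset (Fin N)) (hV : V.Nonempty) {r : ℕ}
    (h : HasEFOfSize (convexHull ℝ (pt '' (V : Set (Fin N)))) r) :
    ∃ (U : VRow V → Option (Fin r) → ℝ) (T : V → Option (Fin r) → ℝ),
      (∀ a i, 0 ≤ U a i ∧ U a i ≤ (N : ℝ) ^ 2) ∧ (∀ b i, 0 ≤ T b i ∧ T b i ≤ 1) ∧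
      ∀ (a : VRow V) (b : V), dval a.1 - cvec a.1 ⬝ᵥ pt b.1 = ∑ i, U a i * T b i := by
  classical
  obtain ⟨U, T, hU, hT, hUT⟩ := h.exists_nonneg_factorization (v := fun b : V => pt (b : Fin N))
    (fun b => subset_convexHull ℝ _ ⟨b, b.2, rfl⟩) (c := fun a : VRow V => cvec a.1)
    (d := fun a => dval a.1) (fun a x hx => dot_le_of_valid_of_mem_convexHull a.2 hx)
  haveI : Nonempty V := ⟨⟨hV.choose, hV.choose_spec⟩⟩
  -- column maxima
  let μ : Option (Fin r) → ℝ := fun i => Finset.univ.sup' Finset.univ_nonempty fun b : V => T b i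
  have hμ : ∀ b i, T b i ≤ μ i := fun b i => Finset.le_sup' (fun b : V => T b i) (Finset.mem_univ b)
  have hμ0 : ∀ i, 0 ≤ μ i := fun i => by
    obtain ⟨b⟩ := (inferInstance : Nonempty V)
    exact (hT b i).trans (hμ b i)
  have hμatt : ∀ i, ∃ b : V, T b i = μ i := fun i => by
    obtain ⟨b, -, hb⟩ := Finset.exists_mem_eq_sup' Finset.univ_nonempty fun b : V => T b i
    exact ⟨b, hb.symm⟩
  refine ⟨fun a i => U a i * μ i, fun b i => if μ i = 0 then 0 else T b i / μ i, fun a i => ⟨?_, ?_⟩,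
    fun b i => ⟨?_, ?_⟩, fun a b => ?_⟩
  · exact mul_nonneg (hU a i) (hμ0 i)
  · -- `U a i μ i ≤ slack at the maximiser ≤ N²`
    show U a i * μ i ≤ (N : ℝ) ^ 2
    obtain ⟨b, hb⟩ := hμatt i
    have h1 : U a i * T b i ≤ ∑ i', U a i' * T b i' :=
      Finset.single_le_sum (f := fun i' => U a i' * T b i') (fun i' _ => mul_nonneg (hU a i') (hT b i'))
        (Finset.mem_univ i)
    rw [← hUT] at h1
    rw [← hb]
    exact h1.trans (slack_bounds a.2 b.2).2
  · show (0 : ℝ) ≤ (if μ i = 0 then 0 else T b i / μ i)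
    split_ifs with h0
    · exact le_rfl
    · exact div_nonneg (hT b i) (hμ0 i)
  · show (if μ i = 0 then 0 else T b i / μ i) ≤ (1 : ℝ)
    split_ifs with h0
    · exact zero_le_one
    · exact div_le_one_of_le₀ (hμ b i) (hμ0 i)
  · rw [hUT]
    refine Finset.sum_congr rfl fun i _ => ?_
    show U a i * T b i = (U a i * μ i) * (if μ i = 0 then 0 else T b i / μ i)
    split_ifs with h0
    · have : T b i = 0 := le_antisymm (h0 ▸ hμ b i) (hT b i)
      rw [this, mul_zero, mul_zero]
    · field_simp

/-! ### Stage C. Rounding, codes and decoding (Lemma 5, the set `Y`)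

We reuse the grid of Rothvoß's Theorem 3 as typed in `ZeroOneLpEF` with `n = 2`:
`D = dimBound 2 r = r + 4 = dim (ℝ² × ℝ × ℝ^{r+1})`, `1/η = gridInv 2 r = 2(r+1)D`,
`ε = tol 2 r = 1/(4D)`. -/

/-- Bound `Q = N² / η` on the rounded entries `round(U/η)` (printed: "`U'` … integer multiple of
`1/(8(r+2)n²)` … `‖U'‖_∞ ≤ n`"). [cite: FioriniRothvossTiwary2012, Lemma 5 (p08)] -/
def entryBound (N r : ℕ) : ℕ := N ^ 2 * ZeroOneLpEF.gridInv 2 r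

/-- If `0 ≤ u ≤ N²` then `0 ≤ round(u/η) ≤ Q`. [cite: FioriniRothvossTiwary2012, Lemma 5 (p08)] -/
theorem roundZ_bounds {r : ℕ} {u : ℝ} (hu0 : 0 ≤ u) (hu : u ≤ (N : ℝ) ^ 2) :
    0 ≤ ZeroOneLpEF.roundZ 2 r u ∧ ZeroOneLpEF.roundZ 2 r u ≤ (entryBound N r : ℤ) := by
  have hQ : (N : ℝ) ^ 2 * (ZeroOneLpEF.gridInv 2 r : ℝ) = (entryBound N r : ℝ) := by
    simp only [entryBound]; push_cast; ring
  have hx2 : u * (ZeroOneLpEF.gridInv 2 r : ℝ) ≤ (entryBound N r : ℝ) := by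
    rw [← hQ]; exact mul_le_mul_of_nonneg_right hu (Nat.cast_nonneg (α := ℝ) _)
  have hx1 : 0 ≤ u * (ZeroOneLpEF.gridInv 2 r : ℝ) := mul_nonneg hu0 (Nat.cast_nonneg (α := ℝ) _)
  rw [ZeroOneLpEF.roundZ, round_eq]
  constructor
  · rw [Int.le_floor]; push_cast; linarith
  · have : ⌊u * ↑(ZeroOneLpEF.gridInv 2 r) + 1 / 2⌋ < (entryBound N r : ℤ) + 1 := by
      rw [Int.floor_lt]; push_cast; linarith
    omega

/-- `|Σ_i y_i E_i| ≤ (r+1) δ` when `|y_i| ≤ 1` and `|E_i| ≤ δ`. [folklore] -/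
private theorem abs_sum_mul_le {r : ℕ} {y E : Option (Fin r) → ℝ} {δ : ℝ}
    (hy : ∀ i, |y i| ≤ 1) (hE : ∀ i, |E i| ≤ δ) :
    |∑ i, y i * E i| ≤ ((r : ℝ) + 1) * δ := by
  calc |∑ i, y i * E i| ≤ ∑ i, |y i * E i| := abs_sum_le_sum_abs _ _
    _ ≤ ∑ _i : Option (Fin r), δ := sum_le_sum fun i _ => by
        rw [abs_mul]
        calc |y i| * |E i| ≤ 1 * δ := mul_le_mul (hy i) (hE i) (abs_nonneg _) zero_le_one
          _ = δ := one_mul δ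
    _ = ((r : ℝ) + 1) * δ := by simp [Fintype.card_option]

/-- `(r+1) · η/2 = ε`. [folklore] -/
private theorem succ_mul_half_gridStep (r : ℕ) :
    ((r : ℝ) + 1) * (ZeroOneLpEF.gridStep 2 r / 2) = ZeroOneLpEF.tol 2 r := by
  simp only [ZeroOneLpEF.gridStep, ZeroOneLpEF.tol, ZeroOneLpEF.gridInv, ZeroOneLpEF.dimBound]
  push_cast
  have : (2 : ℝ) + r + 2 ≠ 0 := by positivity
  field_simp
  ring

/-- The code of one row: the chord `(i, j, up)` itself and the rounded nonnegative entries
`round(U_i/η) ∈ [0, Q]`. [cite: FioriniRothvossTiwary2012, Thm. 8 proof (p09: "for each entry there are at most … `≤ cn^{11}` many possible choices")] -/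
abbrev RowCode (N r : ℕ) : Type := Row N × (Option (Fin r) → Fin (entryBound N r + 1))

/-- A code: the number `d ≤ D` of selected rows and `D` row codes (printed: "By padding zeros, we
may assume that this system is of size `(2 + R) × (3 + R)`").
[cite: FioriniRothvossTiwary2012, Thm. 8 proof (p09)] -/
abbrev Code (N r : ℕ) : Type :=
  Fin (ZeroOneLpEF.dimBound 2 r + 1) × (Fin (ZeroOneLpEF.dimBound 2 r) → RowCode N r)

variable {r : ℕ}

/-- The rounded nonnegative row `U'` a row code stands for. [cite: FioriniRothvossTiwary2012, Lemma 5 (p08)] -/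
def RowCode.uvec (c : RowCode N r) : Option (Fin r) → ℝ :=
  fun i => ((c.2 i : ℕ) : ℝ) * ZeroOneLpEF.gridStep 2 r

/-- The decoding test value `b'_i − A'_i x − U'_i y` at the grid point `x = (a_z, a_z²)`.
[cite: FioriniRothvossTiwary2012, Lemma 5 (p08, the set Y)] -/
def testVal (c : RowCode N r) (z : Fin N) (y : Option (Fin r) → ℝ) : ℝ :=
  dval c.1 - cvec c.1 ⬝ᵥ pt z - ∑ i, y i * c.uvec i

/-- **Decoding** (the set `Y` of the printed Lemma 5, read on the grid points of the parabola,
with certificates `y ∈ [0,1]^{r+1}` = `ZeroOneLpEF.Admissible`).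
[cite: FioriniRothvossTiwary2012, Lemma 5 (p08, the set Y)] -/
def decode (c : Code N r) : Finset (Fin N) :=
  @Finset.filter _ (fun z => ∃ y : Option (Fin r) → ℝ, ZeroOneLpEF.Admissible y ∧
    ∀ t : Fin (ZeroOneLpEF.dimBound 2 r), (t : ℕ) < (c.1 : ℕ) →
      |testVal (c.2 t) z y| ≤ ZeroOneLpEF.tol 2 r)
    (Classical.decPred _) univ

/-- Membership in the decoded set. [cite: FioriniRothvossTiwary2012, Lemma 5 (p08, the set Y)] -/
theorem mem_decode {c : Code N r} {z : Fin N} :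
    z ∈ decode c ↔ ∃ y : Option (Fin r) → ℝ, ZeroOneLpEF.Admissible y ∧
      ∀ t : Fin (ZeroOneLpEF.dimBound 2 r), (t : ℕ) < (c.1 : ℕ) →
        |testVal (c.2 t) z y| ≤ ZeroOneLpEF.tol 2 r := by
  simp [decode]

/-- The number of codes. [cite: FioriniRothvossTiwary2012, Thm. 8 proof (p09)] -/
theorem card_code (N r : ℕ) :
    Fintype.card (Code N r) = (ZeroOneLpEF.dimBound 2 r + 1) *
      (N * (N * 2) * (entryBound N r + 1) ^ (r + 1)) ^ ZeroOneLpEF.dimBound 2 r := by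
  simp only [Code, RowCode, Row, Fintype.card_prod, Fintype.card_pi, Fintype.card_fin, prod_const,
    card_univ, Fintype.card_option, Fintype.card_bool]

/-! ### Encoding -/

/-- Clamp an integer into `Fin (m + 1)`. [folklore] -/
private def clampNat (m : ℕ) (x : ℤ) : Fin (m + 1) := ⟨min x.toNat m, by omega⟩

/-- Clamping is exact on `[0, m]`. [folklore] -/
private theorem clampNat_val {m : ℕ} {x : ℤ} (h0 : 0 ≤ x) (hx : x ≤ m) :
    ((clampNat m x : ℕ) : ℤ) = x := by
  have h1 : x.toNat ≤ m := by omega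
  simp [clampNat, min_eq_left h1, Int.toNat_of_nonneg h0]

/-- Encoding of a row from its data `(ρ, round(U/η))`. [cite: FioriniRothvossTiwary2012, Lemma 5 (p08)] -/
def encodeRow (ρ : Row N) (q : Option (Fin r) → ℤ) : RowCode N r :=
  (ρ, fun i => clampNat (entryBound N r) (q i))

/-- Decoding the rounded row of an encoded row. [cite: FioriniRothvossTiwary2012, Lemma 5 (p08)] -/
theorem encodeRow_uvec (ρ : Row N) {q : Option (Fin r) → ℤ}
    (hq : ∀ i, 0 ≤ q i ∧ q i ≤ (entryBound N r : ℤ)) :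
    (encodeRow ρ q).uvec = fun i => (q i : ℝ) * ZeroOneLpEF.gridStep 2 r := by
  funext i
  have h := hq i
  have := clampNat_val (m := entryBound N r) (x := q i) h.1 h.2
  simp only [RowCode.uvec, encodeRow]
  have : ((clampNat (entryBound N r) (q i) : ℕ) : ℝ) = ((q i : ℤ) : ℝ) := by
    exact_mod_cast this
  rw [this]

/-- Linear combinations pass through the pairing with a fixed vector. [folklore] -/
private theorem sum_smul_dotProduct {d : ℕ} (ν : Fin d → ℝ) (v : Fin d → Fin 2 → ℝ)
    (x : Fin 2 → ℝ) : (∑ t, ν t • v t) ⬝ᵥ x = ∑ t, ν t * (v t ⬝ᵥ x) := by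
  simp only [dotProduct, Finset.sum_apply, Pi.smul_apply, smul_eq_mul, Finset.sum_mul, Finset.mul_sum,
    mul_assoc]
  rw [Finset.sum_comm]

/-- Linear combinations pass through the pairing `U ↦ Σ_i y_i U_i`. [folklore] -/
private theorem sum_mul_sum_smul {d : ℕ} (ν : Fin d → ℝ) (V : Fin d → Option (Fin r) → ℝ)
    (y : Option (Fin r) → ℝ) : ∑ i, y i * (∑ t, ν t • V t) i = ∑ t, ν t * ∑ i, y i * V t i := by
  simp only [Finset.sum_apply, Pi.smul_apply, smul_eq_mul, Finset.mul_sum]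
  rw [Finset.sum_comm]
  refine Finset.sum_congr rfl fun t _ => Finset.sum_congr rfl fun i _ => ?_
  ring

/-- The dimension of the coefficient space `ℝ² × ℝ × ℝ^{r+1}` is `D = r + 4`. [folklore] -/
private theorem finrank_coeffSpace (r : ℕ) :
    Module.finrank ℝ ((Fin 2 → ℝ) × ℝ × (Option (Fin r) → ℝ)) = ZeroOneLpEF.dimBound 2 r := by
  simp only [Module.finrank_prod, Module.finrank_self, Module.finrank_fintype_fun_eq_card,
    Fintype.card_option, Fintype.card_fin, ZeroOneLpEF.dimBound]
  ring

/-- `D > 0`. [folklore] -/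
private theorem dimBound_pos (r : ℕ) : 0 < ZeroOneLpEF.dimBound 2 r := by
  unfold ZeroOneLpEF.dimBound; omega

/-- **Encoding (injectivity), Lemma 5: `X = Y`.** If `conv{(a_z, a_z²) : z ∈ V}` (`V ≠ ∅`) has an
extended formulation of size `r` then some code decodes to exactly `V`: members pass the test with
their own normalised column `y = T_v`; a non-member `z` violates a valid chord inequality by `≥ 1`
(Claim 7: "`x ∈ P` … there is some constraint `ℓ` with `A_ℓ x ≥ b_ℓ + 1`"), `U_ℓ y ≥ 0`, and the
`[-1,1]`-combination over the volume-maximising subsystem (Cramer's rule, the tree's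
`ZeroOneSdpLift.exists_subfamily_coeff_le_one`) forces one selected test value above
`1/D − ε > ε`. [cite: FioriniRothvossTiwary2012, Lemma 5 with Claims 6–7 (p08–p09)] -/
theorem exists_code_decode_eq {V : Finset (Fin N)} (hV : V.Nonempty)
    (h : HasEFOfSize (convexHull ℝ (pt '' (V : Set (Fin N)))) r) :
    ∃ c : Code N r, decode c = V := by
  classical
  obtain ⟨U, T, hU, hT, hUT⟩ := exists_bounded_factors V hV h
  set w : VRow V → (Fin 2 → ℝ) × ℝ × (Option (Fin r) → ℝ) :=
    fun a => (cvec a.1, dval a.1, U a) with hw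
  obtain ⟨d, sel, hd, hcoef⟩ := ZeroOneSdpLift.exists_subfamily_coeff_le_one w
  rw [finrank_coeffSpace] at hd
  set q : VRow V → Option (Fin r) → ℤ := fun a i => ZeroOneLpEF.roundZ 2 r (U a i) with hq
  set Ubar : VRow V → Option (Fin r) → ℝ := fun a i => (q a i : ℝ) * ZeroOneLpEF.gridStep 2 r
    with hUbar
  have hUerr : ∀ a i, |(U a - Ubar a) i| ≤ ZeroOneLpEF.gridStep 2 r / 2 := fun a i => by
    rw [Pi.sub_apply]; exact ZeroOneLpEF.abs_sub_roundZ_mul 2 r (U a i)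
  have hqb : ∀ a i, 0 ≤ q a i ∧ q a i ≤ (entryBound N r : ℤ) := fun a i =>
    roundZ_bounds (hU a i).1 (hU a i).2
  have herr : ∀ a (y : Option (Fin r) → ℝ), ZeroOneLpEF.Admissible y →
      |∑ i, y i * (U a - Ubar a) i| ≤ ZeroOneLpEF.tol 2 r := fun a y hy => by
    rw [← succ_mul_half_gridStep r]
    exact abs_sum_mul_le (fun i => abs_le.2 ⟨by linarith [(hy i).1], (hy i).2⟩) (hUerr a)
  obtain ⟨z₀, hz₀⟩ := hV
  let row : Fin d → RowCode N r := fun t => encodeRow (sel t).1 (q (sel t))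
  let row₀ : RowCode N r := encodeRow (z₀, z₀, false) (fun _ => 0)
  let c : Code N r := (⟨d, by omega⟩, fun t => if ht : (t : ℕ) < d then row ⟨t, ht⟩ else row₀)
  have hrow_fst : ∀ t, (row t).1 = (sel t).1 := fun t => rfl
  have hrow_uvec : ∀ t, (row t).uvec = Ubar (sel t) := fun t => by
    rw [show row t = encodeRow (sel t).1 (q (sel t)) from rfl, encodeRow_uvec _ (hqb (sel t))]
  have hc2 : ∀ (t : ℕ) (ht : t < d), c.2 ⟨t, lt_of_lt_of_le ht hd⟩ = row ⟨t, ht⟩ := fun t ht => by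
    simp [c, dif_pos ht]
  have htest : ∀ (t : Fin d) (z : Fin N) (y : Option (Fin r) → ℝ),
      testVal (row t) z y =
        (dval (sel t).1 - cvec (sel t).1 ⬝ᵥ pt z - ∑ i, y i * U (sel t) i)
          + ∑ i, y i * (U (sel t) - Ubar (sel t)) i := by
    intro t z y
    rw [testVal, hrow_fst, hrow_uvec]
    simp only [Pi.sub_apply, mul_sub, Finset.sum_sub_distrib]
    ring
  refine ⟨c, ?_⟩
  ext z
  rw [mem_decode]
  constructor
  · rintro ⟨y, hyadm, hytest⟩
    by_contra hz
    obtain ⟨ρ, hρ, hviol⟩ := exists_valid_violated ⟨z₀, hz₀⟩ hz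
    set j : VRow V := ⟨ρ, hρ⟩ with hj
    obtain ⟨ν, hν, hwj⟩ := hcoef j
    have h1 : cvec ρ = ∑ t, ν t • cvec (sel t).1 := by
      have := congrArg Prod.fst hwj
      simpa [hw, Prod.fst_sum] using this
    have h2 : dval ρ = ∑ t, ν t * dval (sel t).1 := by
      have := congrArg (fun p => p.2.1) hwj
      simpa [hw, Prod.snd_sum, Prod.fst_sum] using this
    have h3 : U j = ∑ t, ν t • U (sel t) := by
      have := congrArg (fun p => p.2.2) hwj
      simpa [hw, Prod.snd_sum] using this
    set S : Fin d → ℝ := fun t =>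
      dval (sel t).1 - cvec (sel t).1 ⬝ᵥ pt z - ∑ i, y i * U (sel t) i with hS
    have hcomb : dval ρ - cvec ρ ⬝ᵥ pt z - ∑ i, y i * U j i = ∑ t, ν t * S t := by
      rw [h1, h2, h3, sum_smul_dotProduct, sum_mul_sum_smul, ← Finset.sum_sub_distrib,
        ← Finset.sum_sub_distrib]
      refine Finset.sum_congr rfl fun t _ => ?_
      rw [hS]; ring
    have hneg : dval ρ - cvec ρ ⬝ᵥ pt z ≤ -1 := by
      rw [slack_eq]; exact_mod_cast hviol
    have hpos : 0 ≤ ∑ i, y i * U j i :=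
      Finset.sum_nonneg fun i _ => mul_nonneg (hyadm i).1 (hU j i).1
    have hone : 1 ≤ ∑ t, |S t| := by
      have hle : ∑ t, ν t * S t ≤ -1 := by rw [← hcomb]; linarith
      calc (1 : ℝ) ≤ |∑ t, ν t * S t| := by
            rw [abs_of_nonpos (by linarith)]; linarith
        _ ≤ ∑ t, |ν t * S t| := abs_sum_le_sum_abs _ _
        _ ≤ ∑ t, |S t| := sum_le_sum fun t _ => by
            rw [abs_mul]
            exact mul_le_of_le_one_left (abs_nonneg _) (hν t)
    have hdpos : 0 < d := by
      by_contra hd0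
      have hd0' : d = 0 := by omega
      subst hd0'
      rw [Fintype.sum_empty] at hone
      linarith
    have hDpos : (0 : ℝ) < ZeroOneLpEF.dimBound 2 r := by exact_mod_cast dimBound_pos r
    obtain ⟨t, -, ht⟩ : ∃ t ∈ (univ : Finset (Fin d)),
        1 / (ZeroOneLpEF.dimBound 2 r : ℝ) ≤ |S t| := by
      apply Finset.exists_le_of_sum_le (univ_nonempty_iff.2 ⟨⟨0, hdpos⟩⟩)
      rw [Finset.sum_const, Finset.card_univ, Fintype.card_fin, nsmul_eq_mul, mul_one_div]
      calc (d : ℝ) / ZeroOneLpEF.dimBound 2 r ≤ 1 := by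
            rw [div_le_one hDpos]; exact_mod_cast hd
        _ ≤ ∑ t, |S t| := hone
    have hyt := hytest ⟨t, lt_of_lt_of_le t.2 hd⟩ t.2
    rw [hc2 t t.2, Fin.eta, htest t z y] at hyt
    have he := herr (sel t) y hyadm
    have hSle : |S t| ≤ ZeroOneLpEF.tol 2 r + ZeroOneLpEF.tol 2 r := by
      have := abs_add_le (S t + ∑ i, y i * (U (sel t) - Ubar (sel t)) i)
        (-(∑ i, y i * (U (sel t) - Ubar (sel t)) i))
      rw [add_neg_cancel_right, abs_neg] at this
      linarith
    have htol4 : ZeroOneLpEF.tol 2 r = (1 / (ZeroOneLpEF.dimBound 2 r : ℝ)) / 4 := by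
      rw [ZeroOneLpEF.tol]; ring
    have hp : 0 < 1 / (ZeroOneLpEF.dimBound 2 r : ℝ) := by positivity
    rw [htol4] at hSle
    linarith
  · intro hz
    refine ⟨T ⟨z, hz⟩, fun i => hT _ i, fun t ht => ?_⟩
    have ht' : (t : ℕ) < d := by simpa [c] using ht
    have hct : c.2 t = row ⟨t, ht'⟩ := by
      have := hc2 t ht'; simpa using this
    have hzero : dval (sel ⟨t, ht'⟩).1 - cvec (sel ⟨t, ht'⟩).1 ⬝ᵥ pt z
        - ∑ i, T ⟨z, hz⟩ i * U (sel ⟨t, ht'⟩) i = 0 := by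
      rw [hUT (sel ⟨t, ht'⟩) ⟨z, hz⟩]
      simp only [mul_comm (T _ _) (U _ _), sub_self]
    rw [hct, htest, hzero, zero_add]
    exact herr _ _ (fun i => hT _ i)

/-! ### Stage D. Counting (Theorem 8) -/

/-- The grid points are distinct. [folklore] -/
private theorem pt_injective : Function.Injective (pt : Fin N → Fin 2 → ℝ) := fun a b h => by
  have h0 := congrFun h 0
  simp only [pt, absc, Matrix.cons_val_zero] at h0
  exact Fin.ext (by exact_mod_cast (add_right_cancel h0))

/-- A bounded set containing two distinct points is not the projection of an affine subspace: it
has no extended formulation of size `0`. [folklore] -/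
private theorem not_hasEFOfSize_zero {ι : Type} [Fintype ι] {C : Set (ι → ℝ)} (hC : Bornology.IsBounded C)
    {p q : ι → ℝ} (hp : p ∈ C) (hq : q ∈ C) (hpq : p ≠ q) : ¬ HasEFOfSize C 0 := by
  rintro ⟨Q, hQ⟩
  have hF : ∀ y : Fin 0 → ℝ, Q.F *ᵥ y = 0 := fun y => by
    funext i; simp [Matrix.mulVec, dotProduct]
  have hline : ∀ t : ℝ, p + t • (q - p) ∈ C := by
    intro t
    rw [← hQ] at hp hq ⊢
    obtain ⟨yp, -, hEp⟩ := hp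
    obtain ⟨yq, -, hEq⟩ := hq
    rw [hF, add_zero] at hEp hEq
    refine ⟨yp, fun j => j.elim0, ?_⟩
    rw [hF, add_zero, Matrix.mulVec_add, Matrix.mulVec_smul, Matrix.mulVec_sub, hEp, hEq, sub_self,
      smul_zero, add_zero]
  obtain ⟨M, hM⟩ := hC.exists_norm_le
  have hMp : ‖p‖ ≤ M := hM p hp
  have hqp : 0 < ‖q - p‖ := norm_pos_iff.2 (sub_ne_zero.2 hpq.symm)
  set t : ℝ := (M + ‖p‖ + 1) / ‖q - p‖ with ht
  have ht0 : 0 ≤ t := div_nonneg (by linarith [norm_nonneg p]) hqp.le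
  have h1 := hM _ (hline t)
  have h2 : ‖t • (q - p)‖ ≤ ‖p + t • (q - p)‖ + ‖p‖ := by
    have := norm_sub_le (p + t • (q - p)) p
    rwa [add_sub_cancel_left] at this
  have h3 : ‖t • (q - p)‖ = M + ‖p‖ + 1 := by
    rw [norm_smul, Real.norm_eq_abs, abs_of_nonneg ht0, ht, div_mul_cancel₀ _ hqp.ne']
  linarith

/-- If every `n`-subset `V` of the `2n` grid points spans a polygon `conv{(a_z, a_z²) : z ∈ V}` with an
extended formulation of size `R`, then decoding hits every `n`-subset: `C(2n, n) ≤ #codes`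
(printed: "every subset `X ⊆ Z` of size `|X| = n` yields a different convex `n`-gon … the map `Φ`
must be injective"). [cite: FioriniRothvossTiwary2012, Thm. 8 proof (p09)] -/
theorem choose_le_card_code {n R : ℕ} (hn : 1 ≤ n)
    (hall : ∀ V : Finset (Fin (2 * n)), V.card = n →
      HasEFOfSize (convexHull ℝ (pt '' (V : Set (Fin (2 * n))))) R) :
    (2 * n).choose n ≤ Fintype.card (Code (2 * n) R) := by
  classical
  set 𝓕 := (Finset.univ : Finset (Fin (2 * n))).powersetCard n with h𝓕def
  have h𝓕 : 𝓕.card = (2 * n).choose n := by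
    rw [h𝓕def, Finset.card_powersetCard, Finset.card_univ, Fintype.card_fin]
  have hsub : 𝓕 ⊆ (Finset.univ : Finset (Code (2 * n) R)).image decode := fun V hV => by
    have hcard : V.card = n := (Finset.mem_powersetCard.1 hV).2
    have hne : V.Nonempty := by rw [← Finset.card_pos, hcard]; exact hn
    obtain ⟨c, hc⟩ := exists_code_decode_eq hne (hall V hcard)
    exact Finset.mem_image.2 ⟨c, Finset.mem_univ _, hc⟩
  calc (2 * n).choose n = 𝓕.card := h𝓕.symm
    _ ≤ ((Finset.univ : Finset (Code (2 * n) R)).image decode).card := Finset.card_le_card hsub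
    _ ≤ (Finset.univ : Finset (Code (2 * n) R)).card := Finset.card_image_le
    _ = Fintype.card (Code (2 * n) R) := Finset.card_univ

/-- The number of codes is at most `2^{200 ⌊log₂ n⌋ R²}` (`N = 2n`, `n ≥ 2`, `1 ≤ R ≤ n`; printed:
"the number of such systems is bounded by `(cn^{11})^{(3+R)·(2+R)} ≤ 2^{c' log n · R²}`").
[cite: FioriniRothvossTiwary2012, Thm. 8 proof (p09)] -/
theorem card_code_le_two_pow {n R : ℕ} (hn : 2 ≤ n) (hR : 1 ≤ R) (hRn : R ≤ n) :
    Fintype.card (Code (2 * n) R) ≤ 2 ^ (200 * Nat.log 2 n * R ^ 2) := by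
  rw [card_code]
  set L := Nat.log 2 n with hL
  have hL1 : 1 ≤ L := Nat.log_pos one_lt_two hn
  have hnL : n < 2 ^ (L + 1) := Nat.lt_pow_succ_log_self one_lt_two n
  set M := 2 ^ (L + 1) with hM
  have hnM : n ≤ M := hnL.le
  have hD : ZeroOneLpEF.dimBound 2 R = R + 4 := by unfold ZeroOneLpEF.dimBound; ring
  have hG : ZeroOneLpEF.gridInv 2 R = 2 * (R + 1) * (R + 4) := by
    unfold ZeroOneLpEF.gridInv ZeroOneLpEF.dimBound; ring
  have hM2 : M * M = 2 ^ (2 * L + 2) := by rw [hM, ← pow_add]; ring_nf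
  -- the `2N² = 8n²` chords
  have hrow : 2 * n * (2 * n * 2) ≤ 2 ^ (7 * L) := by
    calc 2 * n * (2 * n * 2) = 8 * (n * n) := by ring
      _ ≤ 8 * (M * M) := Nat.mul_le_mul_left _ (Nat.mul_le_mul hnM hnM)
      _ = 2 ^ (2 * L + 5) := by
          rw [hM2, show (8 : ℕ) = 2 ^ 3 by norm_num, ← pow_add]; ring_nf
      _ ≤ 2 ^ (7 * L) := Nat.pow_le_pow_right (by norm_num) (by omega)
  -- the rounded entries
  have hE : entryBound (2 * n) R + 1 ≤ 2 ^ (15 * L) := by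
    have h1 : entryBound (2 * n) R = (2 * n) ^ 2 * (2 * (R + 1) * (R + 4)) := by rw [entryBound, hG]
    have h2 : 2 * (R + 1) * (R + 4) ≤ 20 * (n * n) := by nlinarith
    have h3 : entryBound (2 * n) R ≤ 80 * ((n * n) * (n * n)) := by
      rw [h1]
      calc (2 * n) ^ 2 * (2 * (R + 1) * (R + 4)) ≤ (2 * n) ^ 2 * (20 * (n * n)) :=
            Nat.mul_le_mul_left _ h2
        _ = 80 * ((n * n) * (n * n)) := by ring
    have h4 : (n * n) * (n * n) ≤ (M * M) * (M * M) :=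
      Nat.mul_le_mul (Nat.mul_le_mul hnM hnM) (Nat.mul_le_mul hnM hnM)
    have h5 : (M * M) * (M * M) = 2 ^ (4 * L + 4) := by rw [hM2, ← pow_add]; ring_nf
    have h6 : 1 ≤ 2 ^ (4 * L + 4) := Nat.one_le_two_pow
    calc entryBound (2 * n) R + 1 ≤ 80 * ((M * M) * (M * M)) + 2 ^ (4 * L + 4) := by
          have := Nat.mul_le_mul_left 80 h4; omega
      _ = 81 * 2 ^ (4 * L + 4) := by rw [h5]; ring
      _ ≤ 2 ^ 7 * 2 ^ (4 * L + 4) := Nat.mul_le_mul_right _ (by norm_num)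
      _ = 2 ^ (4 * L + 11) := by rw [← pow_add]; ring_nf
      _ ≤ 2 ^ (15 * L) := Nat.pow_le_pow_right (by norm_num) (by omega)
  have hinner : 2 * n * (2 * n * 2) * (entryBound (2 * n) R + 1) ^ (R + 1) ≤ 2 ^ (37 * L * R) := by
    calc 2 * n * (2 * n * 2) * (entryBound (2 * n) R + 1) ^ (R + 1)
        ≤ 2 ^ (7 * L) * (2 ^ (15 * L)) ^ (R + 1) := Nat.mul_le_mul hrow (Nat.pow_le_pow_left hE _)
      _ = 2 ^ (7 * L + 15 * L * (R + 1)) := by rw [← pow_mul, ← pow_add]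
      _ ≤ 2 ^ (37 * L * R) := Nat.pow_le_pow_right (by norm_num) (by nlinarith)
  have hpowD : (2 * n * (2 * n * 2) * (entryBound (2 * n) R + 1) ^ (R + 1)) ^ ZeroOneLpEF.dimBound 2 R
      ≤ 2 ^ (185 * L * R ^ 2) := by
    calc (2 * n * (2 * n * 2) * (entryBound (2 * n) R + 1) ^ (R + 1)) ^ ZeroOneLpEF.dimBound 2 R
        ≤ (2 ^ (37 * L * R)) ^ ZeroOneLpEF.dimBound 2 R := Nat.pow_le_pow_left hinner _
      _ = 2 ^ (37 * L * R * (R + 4)) := by rw [← pow_mul, hD]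
      _ ≤ 2 ^ (185 * L * R ^ 2) := Nat.pow_le_pow_right (by norm_num) (by
          have h3 : L * R ≤ L * R ^ 2 := Nat.mul_le_mul_left _ (Nat.le_self_pow two_ne_zero R)
          calc 37 * L * R * (R + 4) = 37 * (L * R ^ 2) + 148 * (L * R) := by ring
            _ ≤ 37 * (L * R ^ 2) + 148 * (L * R ^ 2) := by omega
            _ = 185 * L * R ^ 2 := by ring)
  have hD1 : ZeroOneLpEF.dimBound 2 R + 1 ≤ 2 ^ (6 * L * R ^ 2) := by
    rw [hD]
    calc R + 4 + 1 ≤ 2 ^ (R + 4 + 1) := (Nat.lt_two_pow_self).le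
      _ ≤ 2 ^ (6 * L * R ^ 2) := Nat.pow_le_pow_right (by norm_num) (by nlinarith)
  calc (ZeroOneLpEF.dimBound 2 R + 1) *
        (2 * n * (2 * n * 2) * (entryBound (2 * n) R + 1) ^ (R + 1)) ^ ZeroOneLpEF.dimBound 2 R
      ≤ 2 ^ (6 * L * R ^ 2) * 2 ^ (185 * L * R ^ 2) := Nat.mul_le_mul hD1 hpowD
    _ = 2 ^ (191 * L * R ^ 2) := by rw [← pow_add]; ring_nf
    _ ≤ 2 ^ (200 * L * R ^ 2) := Nat.pow_le_pow_right (by norm_num) (by nlinarith)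

/-- **Counting.** If every `n`-subset of the `2n` grid points spans a polygon with an extended
formulation of size `R` (`n ≥ 2`, `1 ≤ R ≤ n`) then `n ≤ 102 ⌊log₂ n⌋ R²` (printed: "We conclude
that `2^{c' log₂ n · R²} ≥ 2ⁿ`", here from `C(2n, n) ≥ 4ⁿ/(2n)` subsets).
[cite: FioriniRothvossTiwary2012, Thm. 8 proof (p09)] -/
theorem le_log_mul_sq_of_forall {n R : ℕ} (hn : 2 ≤ n) (hR : 1 ≤ R) (hRn : R ≤ n)
    (hall : ∀ V : Finset (Fin (2 * n)), V.card = n →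
      HasEFOfSize (convexHull ℝ (pt '' (V : Set (Fin (2 * n))))) R) :
    n ≤ 102 * Nat.log 2 n * R ^ 2 := by
  set L := Nat.log 2 n with hL
  have hL1 : 1 ≤ L := Nat.log_pos one_lt_two hn
  have hnL : n < 2 ^ (L + 1) := Nat.lt_pow_succ_log_self one_lt_two n
  have h4 : 4 ^ n ≤ 2 * n * (2 * n).choose n := by
    rw [← Nat.centralBinom_eq_two_mul_choose]
    exact Nat.four_pow_le_two_mul_self_mul_centralBinom n (by omega)
  have hcount := (choose_le_card_code (by omega) hall).trans (card_code_le_two_pow hn hR hRn)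
  have h2n : 2 * n ≤ 2 ^ (L + 2) := by rw [pow_succ]; omega
  have : 2 ^ (2 * n) ≤ 2 ^ (L + 2 + 200 * L * R ^ 2) := by
    calc 2 ^ (2 * n) = 4 ^ n := by rw [pow_mul]; norm_num
      _ ≤ 2 * n * (2 * n).choose n := h4
      _ ≤ 2 ^ (L + 2) * 2 ^ (200 * L * R ^ 2) := Nat.mul_le_mul h2n hcount
      _ = 2 ^ (L + 2 + 200 * L * R ^ 2) := by rw [← pow_add]
  have h := (Nat.pow_le_pow_iff_right (by norm_num : 1 < 2)).1 this
  have hLR : L ≤ L * R ^ 2 := Nat.le_mul_of_pos_right _ (by positivity)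
  have key : 2 * n ≤ 203 * (L * R ^ 2) := by nlinarith
  calc n ≤ 102 * (L * R ^ 2) := by omega
    _ = 102 * L * R ^ 2 := by ring

/-- **Existence of an `n`-subset without small extended formulations.** If `n ≥ 2`, `1 ≤ R ≤ n`
and `102 ⌊log₂ n⌋ R² < n`, some `n`-subset of the grid spans a polygon with NO extended formulation of
any size `k ≤ R` (printed: "Let `R := max{xc(conv(X)) …}`"). [cite: FioriniRothvossTiwary2012, Thm. 8 proof (p09)] -/
theorem exists_forall_not_hasEFOfSize {n R : ℕ} (hn : 2 ≤ n) (hR : 1 ≤ R) (hRn : R ≤ n)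
    (hlt : 102 * Nat.log 2 n * R ^ 2 < n) :
    ∃ V : Finset (Fin (2 * n)), V.card = n ∧
      ∀ k ≤ R, ¬ HasEFOfSize (convexHull ℝ (pt '' (V : Set (Fin (2 * n))))) k := by
  by_contra hcon
  push Not at hcon
  have hall : ∀ V : Finset (Fin (2 * n)), V.card = n →
      HasEFOfSize (convexHull ℝ (pt '' (V : Set (Fin (2 * n))))) R := fun V hV => by
    obtain ⟨k, hk, h⟩ := hcon V hV
    exact h.of_le hk
  exact absurd (le_log_mul_sq_of_forall hn hR hRn hall) (not_le.2 hlt)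

/-- **Fiorini–Rothvoß–Tiwary 2012, Theorem 8 — explicit `log₂` form.** For every `n ≥ 2` some
`n`-subset `V` of the grid `{(z, z²) : z ∈ [2n]}` spans a convex `n`-gon ALL of whose (slack-form)
extended formulations have size `k` with `n ≤ 102 · ⌊log₂ n⌋ · k²`, i.e.
`k ≥ √(n / (102 log₂ n))`. [cite: FioriniRothvossTiwary2012, Thm. 8 (p09)] -/
theorem exists_ngon_le_log_mul_sq {n : ℕ} (hn : 2 ≤ n) :
    ∃ V : Finset (Fin (2 * n)), V.card = n ∧
      ∀ k : ℕ, HasEFOfSize (convexHull ℝ (pt '' (V : Set (Fin (2 * n))))) k →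
        n ≤ 102 * Nat.log 2 n * k ^ 2 := by
  classical
  set L := Nat.log 2 n with hL
  have hL1 : 1 ≤ L := Nat.log_pos one_lt_two hn
  -- size `0` is impossible for every `n`-subset (two distinct points, bounded hull)
  have hk0 : ∀ V : Finset (Fin (2 * n)), V.card = n → ∀ k,
      HasEFOfSize (convexHull ℝ (pt '' (V : Set (Fin (2 * n))))) k → 1 ≤ k := by
    intro V hV k hk
    by_contra h0
    have hk' : k = 0 := by omega
    subst hk'
    have h1 : 1 < V.card := by omega
    obtain ⟨a, ha, b, hb, hab⟩ := Finset.one_lt_card.1 h1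
    have hcpt : IsCompact (convexHull ℝ (pt '' (V : Set (Fin (2 * n))))) :=
      (((V : Set (Fin (2 * n))).toFinite).image pt).isCompact_convexHull ℝ
    exact not_hasEFOfSize_zero hcpt.isBounded
      (subset_convexHull ℝ _ ⟨a, ha, rfl⟩) (subset_convexHull ℝ _ ⟨b, hb, rfl⟩)
      (fun h => hab (pt_injective h)) hk
  set P : ℕ → Prop := fun R => 102 * L * R ^ 2 < n with hP
  by_cases hP1 : P 1
  · set R₀ := Nat.findGreatest P n with hR₀
    have h1R₀ : 1 ≤ R₀ := Nat.le_findGreatest (by omega) hP1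
    have hR₀n : R₀ ≤ n := Nat.findGreatest_le n
    have hPR₀ : P R₀ := Nat.findGreatest_spec (P := P) (show 1 ≤ n by omega) hP1
    obtain ⟨V, hV, hnot⟩ := exists_forall_not_hasEFOfSize hn h1R₀ hR₀n hPR₀
    refine ⟨V, hV, fun k hk => ?_⟩
    have hkR : R₀ < k := by
      by_contra hle
      exact hnot k (not_lt.1 hle) hk
    by_cases hkn : k ≤ n
    · exact not_lt.1 (Nat.findGreatest_is_greatest (P := P) hkR hkn)
    · have h1 : n ≤ k ^ 2 := by nlinarith
      calc n ≤ k ^ 2 := h1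
        _ = 1 * 1 * k ^ 2 := by ring
        _ ≤ 102 * L * k ^ 2 := by gcongr; omega
  · -- `n ≤ 102 L`: any `n`-subset works
    have hPn : n ≤ 102 * L := by
      have : ¬ 102 * L * 1 ^ 2 < n := hP1
      simpa using this
    obtain ⟨V, -, hV⟩ : ∃ V : Finset (Fin (2 * n)), V ⊆ Finset.univ ∧ V.card = n :=
      Finset.exists_subset_card_eq (by simp; omega)
    refine ⟨V, hV, fun k hk => ?_⟩
    have h1 := hk0 V hV k hk
    calc n ≤ 102 * L := hPn
      _ = 102 * L * 1 ^ 2 := by ring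
      _ ≤ 102 * L * k ^ 2 := by gcongr

/-! ### The parabola points are in convex position -/

/-- A point of a finite family that is the unique maximiser of a rational linear functional among
the family is an extreme point of the convex hull of the family (the tree's
`GenericPsdRank.dotRat_le_of_mem_convexHull` / `eq_of_isMax_dotRat`). [folklore] -/
private theorem mem_extremePoints_of_strict {v m : ℕ} (x : Fin v → (Fin m → ℝ)) (i : Fin v) (ω : Fin m → ℚ)
    (hω : ∀ j, j ≠ i → GenericPsdRank.dotRat ω (x j) < GenericPsdRank.dotRat ω (x i)) :
    x i ∈ (convexHull ℝ (Set.range x)).extremePoints ℝ := by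
  rw [mem_extremePoints]
  refine ⟨subset_convexHull ℝ _ ⟨i, rfl⟩, fun x₁ hx₁ x₂ hx₂ hseg => ?_⟩
  obtain ⟨a, b, ha, hb, hab, hcomb⟩ := hseg
  have h1 := GenericPsdRank.dotRat_le_of_mem_convexHull x i ω hω hx₁
  have h2 := GenericPsdRank.dotRat_le_of_mem_convexHull x i ω hω hx₂
  have hlin : GenericPsdRank.dotRat ω (x i) =
      a * GenericPsdRank.dotRat ω x₁ + b * GenericPsdRank.dotRat ω x₂ := by
    rw [← hcomb]
    simp only [GenericPsdRank.dotRat, Pi.add_apply, Pi.smul_apply, smul_eq_mul, Finset.mul_sum,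
      ← Finset.sum_add_distrib]
    exact Finset.sum_congr rfl fun l _ => by ring
  have h3 : a * GenericPsdRank.dotRat ω (x i) + b * GenericPsdRank.dotRat ω (x i) =
      GenericPsdRank.dotRat ω (x i) := by rw [← add_mul, hab, one_mul]
  have h1' : GenericPsdRank.dotRat ω (x i) ≤ GenericPsdRank.dotRat ω x₁ := by
    by_contra hlt
    rw [not_le] at hlt
    have := mul_lt_mul_of_pos_left hlt ha
    linarith [mul_le_mul_of_nonneg_left h2 hb.le]
  have h2' : GenericPsdRank.dotRat ω (x i) ≤ GenericPsdRank.dotRat ω x₂ := by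
    by_contra hlt
    rw [not_le] at hlt
    have := mul_lt_mul_of_pos_left hlt hb
    linarith [mul_le_mul_of_nonneg_left h1 ha.le]
  exact ⟨GenericPsdRank.eq_of_isMax_dotRat x i ω hω hx₁ h1',
    GenericPsdRank.eq_of_isMax_dotRat x i ω hω hx₂ h2'⟩

/-- **Strict convexity of the parabola**: the functional `2 a_z x₁ − x₂` is maximised, among the
grid points, exactly at `(a_z, a_z²)` (value `a_z² − (a_w − a_z)²` at `(a_w, a_w²)`); so an injective
family of grid points is in convex position (printed: "The set `Z := {(z, z²) | z ∈ [2n]}` is convex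
independent"). [cite: FioriniRothvossTiwary2012, Thm. 8 proof (p09)] -/
theorem pt_mem_extremePoints {v : ℕ} (e : Fin v → Fin N) (he : Function.Injective e) (i : Fin v) :
    pt (e i) ∈ (convexHull ℝ (Set.range fun j => pt (e j))).extremePoints ℝ := by
  refine mem_extremePoints_of_strict (fun j => pt (e j)) i ![2 * (((e i : ℕ) : ℚ) + 1), -1]
    fun j hj => ?_
  have hne : absc (e j) ≠ absc (e i) := by
    intro h
    apply hj
    apply he
    simp only [absc] at h
    exact Fin.ext (by exact_mod_cast (add_right_cancel h))
  have hsq : 0 < (absc (e j) - absc (e i)) ^ 2 := by positivity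
  simp only [GenericPsdRank.dotRat, pt, Fin.sum_univ_two, Matrix.cons_val_zero, Matrix.cons_val_one]
  push_cast
  simp only [absc] at hsq ⊢
  nlinarith [hsq]

end IntegralPolygonXC

open IntegralPolygonXC Literature.Barriers.PneNP in
/-- **Fiorini–Rothvoß–Tiwary 2012, Theorem 8** (Discrete Comput. Geom. 48 (2012) = arXiv:1107.0371,
§5 p09, verbatim): "For every `n ≥ 3`, there exists a convex `n`-gon `P` with vertices in
`[2n] × [4n²]` and `xc(P) = Ω(√n / √(log n))`."  Here `xc` = the least size (number of inequalities)
of an extended formulation (§1–2), equivalently of a slack-form EF `E x + F y = g, y ≥ 0` (the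
tree's `Literature.Barriers.PneNP.HasEFOfSize`, FMPTW §1 "without loss of generality"); `Ω` read as
`∃ c > 0 ∃ n₀ ∀ n ≥ n₀`; the `n`-gon is given by an injective family of `n` points `(z, z²)`,
`z ∈ [2n]`, in convex position (all extreme). PROVED (`c = 1/13`, `n₀ = 2`) from the explicit form
`IntegralPolygonXC.exists_ngon_le_log_mul_sq` (`n ≤ 102 ⌊log₂ n⌋ k²`).
[cite: FioriniRothvossTiwary2012, Thm. 8 (p09); Lemma 4, Lemma 5 (p08–p09)] -/
theorem FioriniRothvossTiwary2012_thm8 :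
    ∃ c : ℝ, 0 < c ∧ ∃ n₀ : ℕ, ∀ n : ℕ, n₀ ≤ n →
      ∃ x : Fin n → (Fin 2 → ℝ),
        (∀ i, ∃ z : ℕ, 1 ≤ z ∧ z ≤ 2 * n ∧ x i = ![(z : ℝ), (z : ℝ) ^ 2]) ∧
        Function.Injective x ∧
        (∀ i, x i ∈ (convexHull ℝ (Set.range x)).extremePoints ℝ) ∧
        ∀ r : ℕ, HasEFOfSize (convexHull ℝ (Set.range x)) r →
          c * Real.sqrt (n / Real.log n) ≤ r := by
  classical
  refine ⟨1 / 13, by norm_num, 2, fun n hn => ?_⟩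
  obtain ⟨V, hV, hVk⟩ := exists_ngon_le_log_mul_sq hn
  set e := V.orderEmbOfFin hV with he
  have hrange : Set.range (fun i => pt (e i)) = pt '' (V : Set (Fin (2 * n))) := by
    rw [show (fun i => pt (e i)) = pt ∘ e from rfl, Set.range_comp, Finset.range_orderEmbOfFin]
  refine ⟨fun i => pt (e i), fun i => ?_, pt_injective.comp e.injective,
    pt_mem_extremePoints e e.injective, fun r hr => ?_⟩
  · refine ⟨(e i : ℕ) + 1, by omega, by have := (e i).2; omega, ?_⟩
    simp only [pt, absc]
    push_cast
    rfl
  rw [hrange] at hr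
  have hnat := hVk r hr
  set L := Nat.log 2 n with hL
  have hn1 : (1 : ℝ) < n := by exact_mod_cast (show 1 < n by omega)
  have hlogn : 0 < Real.log n := Real.log_pos hn1
  have hlog2 : (0.6931471803 : ℝ) < Real.log 2 := Real.log_two_gt_d9
  have hlog2pos : 0 < Real.log 2 := by linarith
  have hLlog : (L : ℝ) * Real.log 2 ≤ Real.log n := by
    have h := Nat.pow_log_le_self 2 (show n ≠ 0 by omega)
    have h' : ((2 : ℝ) ^ L) ≤ n := by exact_mod_cast h
    calc (L : ℝ) * Real.log 2 = Real.log ((2 : ℝ) ^ L) := by rw [Real.log_pow]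
      _ ≤ Real.log n := Real.log_le_log (by positivity) h'
  have hreal : (n : ℝ) ≤ 102 * L * (r : ℝ) ^ 2 := by exact_mod_cast hnat
  have h1 : (n : ℝ) * Real.log 2 ≤ 102 * Real.log n * (r : ℝ) ^ 2 := by
    calc (n : ℝ) * Real.log 2 ≤ 102 * L * (r : ℝ) ^ 2 * Real.log 2 := by gcongr
      _ = 102 * ((L : ℝ) * Real.log 2) * (r : ℝ) ^ 2 := by ring
      _ ≤ 102 * Real.log n * (r : ℝ) ^ 2 := by gcongr
  have hX : 0 ≤ (r : ℝ) ^ 2 * Real.log n := mul_nonneg (sq_nonneg _) hlogn.le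
  have h2 : (n : ℝ) / Real.log n ≤ 148 * (r : ℝ) ^ 2 := by
    rw [div_le_iff₀ hlogn]
    have : (n : ℝ) * Real.log 2 ≤ (148 * (r : ℝ) ^ 2 * Real.log n) * Real.log 2 := by
      calc (n : ℝ) * Real.log 2 ≤ 102 * Real.log n * (r : ℝ) ^ 2 := h1
        _ ≤ (148 * (r : ℝ) ^ 2 * Real.log n) * Real.log 2 := by nlinarith
    exact le_of_mul_le_mul_right this hlog2pos
  have hk0 : (0 : ℝ) ≤ r := Nat.cast_nonneg r
  have hq0 : (0 : ℝ) ≤ n / Real.log n := div_nonneg (Nat.cast_nonneg n) hlogn.le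
  have hA0 : 0 ≤ 1 / 13 * Real.sqrt (n / Real.log n) := by positivity
  rw [← pow_le_pow_iff_left₀ hA0 hk0 (by norm_num : (2 : ℕ) ≠ 0), mul_pow, Real.sq_sqrt hq0]
  nlinarith [h2]

/-! ## Part II — the semidefinite version (Briët–Dadush–Pokutta, Theorem 8)

Source: J. Briët, D. Dadush, S. Pokutta, *On the existence of 0/1 polytopes with high semidefinite
extension complexity*, Math. Program. 153 (2015) 179–199 = arXiv:1305.3268 [BrietDadushPokutta2014];
held text `paper:arxiv-1305.3268`, §5 (p12, verbatim): "In an analogous fashion to [FRT12] we can use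
a slightly adapted version of Theorem 4 [the rounding lemma] to show the existence of a polygon with
`d` integral vertices with semidefinite extension complexity `Ω((d/log d)^{1/4})`."  Lemma 3
(Generalized rounding lemma): "Let `n, N ≥ 2` … `𝒱 ⊆ ℤⁿ ∩ [-N,N]ⁿ` be a nonempty and convex
independent set and `𝒳 := conv(𝒱) ∩ ℤⁿ`. With `r := xc_SDP(conv(𝒳))` and
`δ ≤ (16r³(n+r²))^{-1}`, for every `i ∈ [n+r²]` there exist: an integer vector `a_i ∈ ℤⁿ` such that
`‖a_i‖_∞ ≤ Δ`, an integer `b_i` such that `|b_i| ≤ Δ`, a matrix `U_i ∈ S^r_+(√(rΔ))` whose entries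
are integer multiples of `δ/Δ` …, such that `𝒳 = {x ∈ ℤⁿ | ∃ Y ∈ S^r_+(√(rΔ)) :
|b_i − a_iᵀx − ⟨Y, U_i⟩| ≤ 1/(4(n+r²)) ∀ i ∈ [n+r²]}`."  **Theorem 8** (Integral polygon with high
semidefinite xc): "For every `d ≥ 3`, there exists a `d`-gon `P` with vertices in `[2d] × [4d²]` and
`xc_SDP(P) = Ω((d/log d)^{1/4})`."  Proof (p12): "The proof is identical to the one is [FRT12] except
for adjusting parameters … `Z := {(z,z²) | z ∈ [2d]}` is convex independent … Let
`R := max{xc_SDP(conv(X)) | X ⊆ Z, |X| = d}` … We estimate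
`2^d ≤ (cd^{14})^{(3+R²)²} ≤ 2^{c' · R⁴ · log d}` and hence `R ≥ c' (d/log d)^{1/4}`."

PROVED below (namespace `IntegralPolygonPsd`; psd lifts = the tree's `HasPsdLift`, FGPRT eq. (3),
whose least size is `xc_SDP` for polytopes by FGPRT Thm. 3.3 = `FawziEtAl2015_thm33_holds`, the
reading used for the companion `BrietDadushPokutta2014_thm7`): the rounding lemma on the grid
(`IntegralPolygonPsd.exists_code_decode_eq`), the count `n ≤ 67 ⌊log₂ n⌋ R⁴`
(`le_log_mul_pow_four_of_forall`), the explicit Theorem 8 (`exists_ngon_le_log_mul_pow_four`) and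
the printed form `BrietDadushPokutta2014_thm8` (`c = 1/4`, `n₀ = 2`). The proof transposes the tree's
`ZeroOneSdpLift` (S3–S9 of `ZeroOnePolytopesHighPsdRank.lean`: lift ⇒ bounded psd factors by FGPRT
Thm. 3.3 and the weak rescaling `HasPsdFactorization.rescale_weak`, entrywise rounding to the grid
`η = 1/(2R²(R²+3))`, volume-maximising subsystem in `ℝ² × ℝ × ℝ^{R×R}`, certificates `0 ⪯ Y`,
`|Y_ab| ≤ 1`) to the chord system of Part I, to which the four box rows `1 ≤ x_l ≤ N^l` are added so
that the polyhedron of the system is bounded (needed by Thm. 3.3); same deviations as Part I and as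
recorded in `ZeroOnePolytopesHighPsdRank.lean` (entrywise instead of spectral rounding; weak
rescaling). -/

namespace IntegralPolygonPsd

open IntegralPolygonXC

variable {N : ℕ}

/-! ### P1. The bounded system: valid chords plus the box `[1, N] × [1, N²]` -/

/-- Rows of the bounded system: a chord `(i, j, up)` of the grid parabola, or a box row `(l, up)`
(`x_l ≤ N^{l+1}` if `up`, `−x_l ≤ −1` otherwise). [cite: BrietDadushPokutta2014, Lemma 3 (§5, p12: "`𝒱 ⊆ ℤⁿ ∩ [-N,N]ⁿ`")] -/
abbrev PRow (N : ℕ) : Type := Row N ⊕ (Fin 2 × Bool)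

/-- The box bounds `(N, N²)`. [cite: BrietDadushPokutta2014, Thm. 8 (§5, p12: "vertices in `[2d] × [4d²]`")] -/
def boxBound (N : ℕ) : Fin 2 → ℝ := ![(N : ℝ), (N : ℝ) ^ 2]

/-- Normal vectors of the rows (integers of size `≤ 2N`). [cite: BrietDadushPokutta2014, Lemma 3 (§5, p12)] -/
def pvec : PRow N → Fin 2 → ℝ
  | Sum.inl ρ => cvec ρ
  | Sum.inr (l, true) => Pi.single l 1
  | Sum.inr (l, false) => -Pi.single l 1

/-- Right-hand sides of the rows (integers of size `≤ N²`). [cite: BrietDadushPokutta2014, Lemma 3 (§5, p12)] -/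
def prhs : PRow N → ℝ
  | Sum.inl ρ => dval ρ
  | Sum.inr (l, true) => boxBound N l
  | Sum.inr (_, false) => -1

/-- Validity of a row for the vertex set `V` (box rows are always valid). [cite: BrietDadushPokutta2014, Lemma 3 (§5, p12)] -/
def PValid (V : Finset (Fin N)) : PRow N → Prop
  | Sum.inl ρ => Valid V ρ
  | Sum.inr _ => True

/-- The valid rows. [cite: BrietDadushPokutta2014, Lemma 3 (§5, p12)] -/
abbrev PVRow (V : Finset (Fin N)) : Type := {j : PRow N // PValid V j}

/-- `1 ≤ a_z ≤ N` and `1 ≤ a_z² ≤ N²`. [folklore] -/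
private theorem absc_bounds (z : Fin N) :
    1 ≤ absc z ∧ absc z ≤ N ∧ 1 ≤ absc z ^ 2 ∧ absc z ^ 2 ≤ (N : ℝ) ^ 2 := by
  have h1 : (1 : ℝ) ≤ absc z := by simp only [absc]; linarith [(Nat.cast_nonneg (α := ℝ) (z : ℕ))]
  have h2 : absc z ≤ N := by
    simp only [absc]; exact_mod_cast Nat.succ_le_of_lt z.2
  refine ⟨h1, h2, by nlinarith, by nlinarith⟩

/-- The slack of a valid row at a vertex lies in `[0, N²]`. [folklore] -/
private theorem pslack_bounds {V : Finset (Fin N)} {j : PRow N} (h : PValid V j) {z : Fin N}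
    (hz : z ∈ V) : 0 ≤ prhs j - pvec j ⬝ᵥ pt z ∧ prhs j - pvec j ⬝ᵥ pt z ≤ (N : ℝ) ^ 2 := by
  obtain ⟨h1, h2, h3, h4⟩ := absc_bounds z
  have hN : (1 : ℝ) ≤ N := h1.trans h2
  have hN2 : (N : ℝ) ≤ (N : ℝ) ^ 2 := by nlinarith
  have hpt : ∀ l, 1 ≤ pt z l ∧ pt z l ≤ boxBound N l ∧ boxBound N l ≤ (N : ℝ) ^ 2 := by
    refine Fin.forall_fin_two.2 ⟨?_, ?_⟩
    · simp only [pt, boxBound, Matrix.cons_val_zero]; exact ⟨h1, h2, hN2⟩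
    · simp only [pt, boxBound, Matrix.cons_val_one, Matrix.cons_val_zero]
      exact ⟨h3, h4, le_rfl⟩
  rcases j with ρ | ⟨l, _ | _⟩
  · exact slack_bounds h hz
  · obtain ⟨hl1, hl2, hl3⟩ := hpt l
    simp only [prhs, pvec, neg_dotProduct, single_dotProduct, one_mul]
    constructor <;> linarith
  · obtain ⟨hl1, hl2, hl3⟩ := hpt l
    simp only [prhs, pvec, single_dotProduct, one_mul]
    constructor <;> linarith

/-- A valid row holds on the polygon `conv{(a_z, a_z²) : z ∈ V}`. [folklore] -/
private theorem pvec_dotProduct_le_of_mem_convexHull {V : Finset (Fin N)} {j : PRow N}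
    (h : PValid V j) {x : Fin 2 → ℝ} (hx : x ∈ convexHull ℝ (pt '' (V : Set (Fin N)))) :
    pvec j ⬝ᵥ x ≤ prhs j := by
  have hconv : Convex ℝ {w : Fin 2 → ℝ | pvec j ⬝ᵥ w ≤ prhs j} :=
    convex_halfSpace_le ⟨fun a b => dotProduct_add _ a b, fun c a => dotProduct_smul c _ a⟩ _
  refine convexHull_min ?_ hconv hx
  rintro _ ⟨z, hz, rfl⟩
  have := (pslack_bounds h hz).1
  simp only [Set.mem_setOf_eq]
  linarith

/-- The polyhedron of the valid rows lies in the box `[1, N²]²`, hence is bounded. [folklore] -/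
private theorem isBounded_polyhedron (V : Finset (Fin N)) (hN : 1 ≤ N) :
    Bornology.IsBounded {y : Fin 2 → ℝ | ∀ j : PVRow V, pvec j.1 ⬝ᵥ y ≤ prhs j.1} := by
  refine (Metric.isBounded_Icc (fun _ : Fin 2 => (1 : ℝ)) (fun _ => (N : ℝ) ^ 2)).subset
    fun y hy => ?_
  simp only [Set.mem_setOf_eq] at hy
  have hN' : (1 : ℝ) ≤ N := by exact_mod_cast hN
  refine ⟨fun l => ?_, fun l => ?_⟩
  · have := hy ⟨Sum.inr (l, false), trivial⟩
    simp only [pvec, prhs, neg_dotProduct, single_dotProduct, one_mul] at this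
    linarith
  · have := hy ⟨Sum.inr (l, true), trivial⟩
    simp only [pvec, prhs, single_dotProduct, one_mul, boxBound] at this
    fin_cases l
    · simp at this ⊢; nlinarith
    · simpa using this

/-! ### P3. From a psd lift to entrywise-bounded psd factors of the slacks -/

/-- Entries of `P` with `0 ⪯ P ⪯ I` lie in `[-1, 1]`. [folklore] -/
private theorem abs_apply_le_one_of_posSemidef {R : ℕ} {P : Matrix (Fin R) (Fin R) ℝ}
    (hP : P.PosSemidef) (h1 : (1 - P).PosSemidef) (a b : Fin R) : |P a b| ≤ 1 := by
  have hdiag : ∀ c, P c c ≤ 1 := fun c => by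
    have := h1.diag_nonneg (i := c)
    rw [Matrix.sub_apply, one_apply_eq] at this
    linarith
  have hsymm : P b a = P a b := by simpa using hP.1.apply a b
  have hq : ∀ t : ℝ, 0 ≤ P a a * (t * t) + 2 * P a b * t + P b b := by
    intro t
    have h := (hP.submatrix ![a, b]).dotProduct_mulVec_nonneg ![t, 1]
    simp [dotProduct, mulVec, Fin.sum_univ_two] at h
    rw [hsymm] at h
    nlinarith [h]
  have h1' := hq 1
  have h2' := hq (-1)
  have := hdiag a
  have := hdiag b
  rw [abs_le]; constructor <;> nlinarith

/-- **Bounded psd factors.** If `conv{(a_z, a_z²) : z ∈ V}` (`V ≠ ∅`) has a psd lift of size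
`R ≥ 1`, the slacks of the valid rows factor as `b_j − a_jᵀ v = Tr(X_v U_j)` with psd `X_v` having
entries in `[-1, 1]` and psd `U_j` having entries in `[-R²N², R²N²]` (FGPRT Thm. 3.3 for the bounded
polyhedron of the system, tree `HasPsdLift.hasPsdFactorization_pairSlackMatrix`, then the weak
rescaling `HasPsdFactorization.rescale_weak`; printed: "`U_i ∈ S^r_+(√(rΔ))`").
[cite: BrietDadushPokutta2014, Lemma 3 (§5, p12) with Thm. 4 and Thm. 6 (§2–3)] -/
theorem exists_bounded_factors {V : Finset (Fin N)} (hV : V.Nonempty) {R : ℕ} (hR : 1 ≤ R)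
    (h : HasPsdLift (convexHull ℝ (pt '' (V : Set (Fin N)))) R) :
    ∃ (X : V → Matrix (Fin R) (Fin R) ℝ) (U : PVRow V → Matrix (Fin R) (Fin R) ℝ),
      (∀ x, (X x).PosSemidef ∧ ∀ a b, |X x a b| ≤ 1) ∧
      (∀ j, (U j).PosSemidef ∧ ∀ a b, |U j a b| ≤ (R : ℝ) ^ 2 * (N : ℝ) ^ 2) ∧
      ∀ (x : V) (j : PVRow V), prhs j.1 - pvec j.1 ⬝ᵥ pt x.1 = (X x * U j).trace := by
  classical
  obtain ⟨z₀, hz₀⟩ := hV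
  have hN : 1 ≤ N := Nat.succ_le_of_lt (lt_of_le_of_lt (Nat.zero_le _) z₀.2)
  set e1 := Fintype.equivFin {x // x ∈ V} with he1
  set e2 := Fintype.equivFin (PVRow V) with he2
  set x' : Fin (Fintype.card {x // x ∈ V}) → (Fin 2 → ℝ) := fun i => pt (e1.symm i).1 with hx'
  set a' : Fin (Fintype.card (PVRow V)) → (Fin 2 → ℝ) := fun j => pvec (e2.symm j).1 with ha'
  set b' : Fin (Fintype.card (PVRow V)) → ℝ := fun j => prhs (e2.symm j).1 with hb'
  have hxC : ∀ i, x' i ∈ convexHull ℝ (pt '' (V : Set (Fin N))) := fun i =>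
    subset_convexHull ℝ _ ⟨(e1.symm i).1, by simp, rfl⟩
  have hQeq : {y : Fin 2 → ℝ | ∀ j, a' j ⬝ᵥ y ≤ b' j} =
      {y : Fin 2 → ℝ | ∀ j : PVRow V, pvec j.1 ⬝ᵥ y ≤ prhs j.1} := by
    ext y
    simp only [Set.mem_setOf_eq, ha', hb']
    constructor
    · intro hy j; simpa using hy (e2 j)
    · intro hy j; exact hy _
  have hsub : convexHull ℝ (pt '' (V : Set (Fin N))) ⊆
      {y : Fin 2 → ℝ | ∀ j : PVRow V, pvec j.1 ⬝ᵥ y ≤ prhs j.1} := fun y hy j =>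
    pvec_dotProduct_le_of_mem_convexHull j.2 hy
  have hfac := HasPsdLift.hasPsdFactorization_pairSlackMatrix (x := x') (a := a') (b := b') hR h hxC
    (by rw [hQeq]; exact hsub) (by rw [hQeq]; exact isBounded_polyhedron V hN)
  set M : {x // x ∈ V} → PVRow V → ℝ := fun x j => prhs j.1 - pvec j.1 ⬝ᵥ pt x.1 with hM
  have hM' : HasPsdFactorization M R := by
    have := hfac.submatrix e1 e2
    refine (show (fun x j => pairSlackMatrix x' a' b' (e1 x) (e2 j)) = M from ?_) ▸ this
    funext x j
    simp [pairSlackMatrix_apply, hM, hx', ha', hb']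
  have hN1 : (1 : ℝ) ≤ N := by exact_mod_cast hN
  have hΔ : (0 : ℝ) < (N : ℝ) ^ 2 := by positivity
  obtain ⟨X, Y, hX, hY, hXY⟩ := HasPsdFactorization.rescale_weak hΔ
    (fun x j => (pslack_bounds j.2 (Finset.coe_mem x)).2) hM'
  refine ⟨X, fun j => ((R : ℝ) ^ 2 * (N : ℝ) ^ 2) • Y j, fun x => ⟨(hX x).1, fun a b =>
    abs_apply_le_one_of_posSemidef (hX x).1 (hX x).2 a b⟩, fun j => ⟨?_, fun a b => ?_⟩,
    fun x j => ?_⟩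
  · exact (hY j).1.smul (by positivity)
  · show |(((R : ℝ) ^ 2 * (N : ℝ) ^ 2) • Y j) a b| ≤ (R : ℝ) ^ 2 * (N : ℝ) ^ 2
    rw [Matrix.smul_apply, smul_eq_mul, abs_mul, abs_of_nonneg (by positivity)]
    exact mul_le_of_le_one_right (by positivity)
      (abs_apply_le_one_of_posSemidef (hY j).1 (hY j).2 a b)
  · show prhs j.1 - pvec j.1 ⬝ᵥ pt x.1 = (X x * (((R : ℝ) ^ 2 * (N : ℝ) ^ 2) • Y j)).trace
    rw [Matrix.mul_smul, trace_smul, smul_eq_mul]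
    exact hXY x j

/-! ### P5. Parameters (the grid of `ZeroOneSdpLift` with `n = 2`: `D = R² + 3`, `1/η = 2R²D`, `ε = 1/(4D)`) -/

/-- Bound `Q = R²N²/η` on the rounded entries `|round(U_ab/η)|`. [cite: BrietDadushPokutta2014, Lemma 3 (§5, p12: "absolute value at most `8r^{3/2}Δ`")] -/
def entryBound (N R : ℕ) : ℕ := N ^ 2 * R ^ 2 * ZeroOneSdpLift.gridInv 2 R

/-- If `|u| ≤ R²N²` then `|round(u/η)| ≤ Q`. [cite: BrietDadushPokutta2014, Lemma 3 (§5, p12)] -/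
theorem abs_roundZ_le {R : ℕ} {u : ℝ} (hu : |u| ≤ (R : ℝ) ^ 2 * (N : ℝ) ^ 2) :
    |ZeroOneSdpLift.roundZ 2 R u| ≤ (entryBound N R : ℤ) := by
  have hQ : (R : ℝ) ^ 2 * (N : ℝ) ^ 2 * (ZeroOneSdpLift.gridInv 2 R : ℝ) = (entryBound N R : ℝ) := by
    simp only [entryBound]; push_cast; ring
  have hx : |u * (ZeroOneSdpLift.gridInv 2 R : ℝ)| ≤ (entryBound N R : ℝ) := by
    rw [abs_mul, abs_of_nonneg (Nat.cast_nonneg (α := ℝ) _), ← hQ]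
    exact mul_le_mul_of_nonneg_right hu (Nat.cast_nonneg (α := ℝ) _)
  obtain ⟨hx1, hx2⟩ := abs_le.1 hx
  rw [ZeroOneSdpLift.roundZ, round_eq, abs_le]
  constructor
  · rw [Int.le_floor]; push_cast; linarith
  · have : ⌊u * ↑(ZeroOneSdpLift.gridInv 2 R) + 1 / 2⌋ < (entryBound N R : ℤ) + 1 := by
      rw [Int.floor_lt]; push_cast; linarith
    omega

/-- `|Tr(Y E)| ≤ R² δ` when `|Y_ab| ≤ 1` and `|E_ab| ≤ δ`. [folklore] -/
private theorem abs_trace_mul_le {R : ℕ} {Y E : Matrix (Fin R) (Fin R) ℝ} {δ : ℝ}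
    (hY : ∀ a b, |Y a b| ≤ 1) (hE : ∀ a b, |E a b| ≤ δ) :
    |(Y * E).trace| ≤ (R : ℝ) ^ 2 * δ := by
  rw [Matrix.trace]
  simp only [Matrix.diag_apply, Matrix.mul_apply]
  calc |∑ a, ∑ b, Y a b * E b a| ≤ ∑ a, |∑ b, Y a b * E b a| := abs_sum_le_sum_abs _ _
    _ ≤ ∑ a, ∑ b, |Y a b * E b a| := sum_le_sum fun a _ => abs_sum_le_sum_abs _ _
    _ ≤ ∑ _a : Fin R, ∑ _b : Fin R, δ := by
      refine sum_le_sum fun a _ => sum_le_sum fun b _ => ?_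
      rw [abs_mul]
      calc |Y a b| * |E b a| ≤ 1 * δ := by
            have hδ : 0 ≤ δ := (abs_nonneg _).trans (hE b a)
            exact mul_le_mul (hY a b) (hE b a) (abs_nonneg _) zero_le_one
        _ = δ := one_mul δ
    _ = (R : ℝ) ^ 2 * δ := by simp [sq, mul_assoc]

/-- `R² · η/2 = ε`. [folklore] -/
private theorem sq_mul_half_gridStep {R : ℕ} (hR : 1 ≤ R) :
    (R : ℝ) ^ 2 * (ZeroOneSdpLift.gridStep 2 R / 2) = ZeroOneSdpLift.tol 2 R := by
  have hR' : (R : ℝ) ≠ 0 := by exact_mod_cast (Nat.one_le_iff_ne_zero.1 hR)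
  have hD : (2 : ℝ) + 1 + R * R ≠ 0 := by positivity
  simp only [ZeroOneSdpLift.gridStep, ZeroOneSdpLift.tol, ZeroOneSdpLift.gridInv,
    ZeroOneSdpLift.dimBound]
  push_cast
  field_simp
  ring

/-- `D > 0`. [folklore] -/
private theorem dimBound_pos (R : ℕ) : 0 < ZeroOneSdpLift.dimBound 2 R := by
  unfold ZeroOneSdpLift.dimBound; omega

/-! ### P6. Codes and decoding -/

/-- The code of one row: the row itself and the rounded matrix entries `round(U_ab/η) ∈ [-Q, Q]`
(shifted by `Q`). [cite: BrietDadushPokutta2014, Thm. 8 proof (§5, p12: "each entry in the system can take at most `cd^{14}` different values")] -/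
abbrev RowCode (N R : ℕ) : Type := PRow N × (Fin R → Fin R → Fin (2 * entryBound N R + 1))

/-- A code: the number `d ≤ D` of selected rows and `D` row codes (printed: "by padding with zeros,
we assume that the system … has the following dimensions"). [cite: BrietDadushPokutta2014, Thm. 8 proof (§5, p12)] -/
abbrev Code (N R : ℕ) : Type :=
  Fin (ZeroOneSdpLift.dimBound 2 R + 1) × (Fin (ZeroOneSdpLift.dimBound 2 R) → RowCode N R)

variable {R : ℕ}

/-- The rounded matrix `Ū` a row code stands for. [cite: BrietDadushPokutta2014, Lemma 3 (§5, p12)] -/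
def RowCode.mat (c : RowCode N R) : Matrix (Fin R) (Fin R) ℝ :=
  fun a b => (((c.2 a b : ℕ) : ℝ) - entryBound N R) * ZeroOneSdpLift.gridStep 2 R

/-- The decoding test value `b_i − a_iᵀ x − ⟨Ū_i, Y⟩` at a grid point (certificates
`ZeroOneSdpLift.Admissible`: `0 ⪯ Y`, `|Y_ab| ≤ 1`). [cite: BrietDadushPokutta2014, Lemma 3 (§5, p12, the set 𝒳)] -/
def testVal (c : RowCode N R) (z : Fin N) (Y : Matrix (Fin R) (Fin R) ℝ) : ℝ :=
  prhs c.1 - pvec c.1 ⬝ᵥ pt z - (Y * c.mat).trace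

/-- **Decoding** on the grid. [cite: BrietDadushPokutta2014, Lemma 3 (§5, p12, the set 𝒳)] -/
def decode (c : Code N R) : Finset (Fin N) :=
  @Finset.filter _ (fun z => ∃ Y : Matrix (Fin R) (Fin R) ℝ, ZeroOneSdpLift.Admissible Y ∧
    ∀ t : Fin (ZeroOneSdpLift.dimBound 2 R), (t : ℕ) < (c.1 : ℕ) →
      |testVal (c.2 t) z Y| ≤ ZeroOneSdpLift.tol 2 R)
    (Classical.decPred _) univ

/-- Membership in the decoded set. [cite: BrietDadushPokutta2014, Lemma 3 (§5, p12, the set 𝒳)] -/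
theorem mem_decode {c : Code N R} {z : Fin N} :
    z ∈ decode c ↔ ∃ Y : Matrix (Fin R) (Fin R) ℝ, ZeroOneSdpLift.Admissible Y ∧
      ∀ t : Fin (ZeroOneSdpLift.dimBound 2 R), (t : ℕ) < (c.1 : ℕ) →
        |testVal (c.2 t) z Y| ≤ ZeroOneSdpLift.tol 2 R := by
  simp [decode]

/-- The number of codes. [cite: BrietDadushPokutta2014, Thm. 8 proof (§5, p12)] -/
theorem card_code (N R : ℕ) :
    Fintype.card (Code N R) = (ZeroOneSdpLift.dimBound 2 R + 1) *
      ((N * (N * 2) + 2 * 2) * (2 * entryBound N R + 1) ^ (R * R)) ^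
        ZeroOneSdpLift.dimBound 2 R := by
  simp only [Code, RowCode, PRow, Row, Fintype.card_prod, Fintype.card_sum, Fintype.card_pi,
    Fintype.card_fin, prod_const, card_univ, Fintype.card_bool, ← pow_mul]

/-! ### P7. Encoding -/

/-- Clamp an integer into `Fin (m + 1)`. [folklore] -/
private def clampNat (m : ℕ) (x : ℤ) : Fin (m + 1) := ⟨min x.toNat m, by omega⟩

/-- Clamping is exact on `[0, m]`. [folklore] -/
private theorem clampNat_val {m : ℕ} {x : ℤ} (h0 : 0 ≤ x) (hx : x ≤ m) :
    ((clampNat m x : ℕ) : ℤ) = x := by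
  have h1 : x.toNat ≤ m := by omega
  simp [clampNat, min_eq_left h1, Int.toNat_of_nonneg h0]

/-- Encoding of a row from its data `(j, round(U/η))`. [cite: BrietDadushPokutta2014, Lemma 3 (§5, p12)] -/
def encodeRow (j : PRow N) (q : Fin R → Fin R → ℤ) : RowCode N R :=
  (j, fun a b => clampNat (2 * entryBound N R) (q a b + entryBound N R))

/-- Decoding the rounded matrix of an encoded row. [cite: BrietDadushPokutta2014, Lemma 3 (§5, p12)] -/
theorem encodeRow_mat (j : PRow N) {q : Fin R → Fin R → ℤ}
    (hq : ∀ a b, |q a b| ≤ (entryBound N R : ℤ)) :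
    (encodeRow j q).mat = fun a b => (q a b : ℝ) * ZeroOneSdpLift.gridStep 2 R := by
  funext a b
  have h := abs_le.1 (hq a b)
  have := clampNat_val (m := 2 * entryBound N R) (x := q a b + entryBound N R) (by omega) (by omega)
  simp only [RowCode.mat, encodeRow]
  have : ((clampNat (2 * entryBound N R) (q a b + entryBound N R) : ℕ) : ℝ)
      = ((q a b + entryBound N R : ℤ) : ℝ) := by
    exact_mod_cast this
  rw [this]; push_cast; ring

/-- Linear combinations pass through the pairing with a fixed vector. [folklore] -/
private theorem sum_smul_dotProduct {d : ℕ} (ν : Fin d → ℝ) (v : Fin d → Fin 2 → ℝ)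
    (x : Fin 2 → ℝ) : (∑ t, ν t • v t) ⬝ᵥ x = ∑ t, ν t * (v t ⬝ᵥ x) := by
  simp only [dotProduct, Finset.sum_apply, Pi.smul_apply, smul_eq_mul, Finset.sum_mul, Finset.mul_sum,
    mul_assoc]
  rw [Finset.sum_comm]

/-- Linear combinations pass through `U ↦ Tr(Y U)`. [folklore] -/
private theorem trace_mul_sum_smul {d : ℕ} (ν : Fin d → ℝ) (V : Fin d → Matrix (Fin R) (Fin R) ℝ)
    (Y : Matrix (Fin R) (Fin R) ℝ) : (Y * ∑ t, ν t • V t).trace = ∑ t, ν t * (Y * V t).trace := by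
  rw [Matrix.mul_sum, Matrix.trace_sum]
  refine Finset.sum_congr rfl fun t _ => ?_
  rw [Matrix.mul_smul, Matrix.trace_smul, smul_eq_mul]

/-- The dimension of the coefficient space `ℝ² × ℝ × ℝ^{R×R}` is `D = R² + 3`. [folklore] -/
private theorem finrank_coeffSpace (R : ℕ) :
    Module.finrank ℝ ((Fin 2 → ℝ) × ℝ × Matrix (Fin R) (Fin R) ℝ) = ZeroOneSdpLift.dimBound 2 R := by
  simp only [Module.finrank_prod, Module.finrank_fin_fun, Module.finrank_self, Module.finrank_matrix,
    Fintype.card_fin, ZeroOneSdpLift.dimBound, mul_one]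
  ring

open Literature.LinearAlgebra.Matrix.NearestPositiveSemidefinite (trace_mul_nonneg) in
/-- **Encoding (injectivity), the generalized rounding lemma on the grid.** If
`conv{(a_z, a_z²) : z ∈ V}` (`V ≠ ∅`) has a psd lift of size `R ≥ 1` then some code decodes to
exactly `V`: members are certified by their own rescaled point factor; a grid point `z ∉ V` violates a
valid chord by `≥ 1`, `⟨U_j, Y⟩ ≥ 0` for admissible `Y`, and the `[-1,1]`-combination over the
volume-maximising subsystem forces a selected test value above `1/D − ε > ε`.
[cite: BrietDadushPokutta2014, Lemma 3 (§5, p12), proof "almost identical to Theorem 4" (Lemma 2, §4)] -/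
theorem exists_code_decode_eq {V : Finset (Fin N)} (hV : V.Nonempty) (hR : 1 ≤ R)
    (h : HasPsdLift (convexHull ℝ (pt '' (V : Set (Fin N)))) R) :
    ∃ c : Code N R, decode c = V := by
  classical
  obtain ⟨X, U, hX, hU, hXU⟩ := exists_bounded_factors hV hR h
  set w : PVRow V → (Fin 2 → ℝ) × ℝ × Matrix (Fin R) (Fin R) ℝ :=
    fun j => (pvec j.1, prhs j.1, U j) with hw
  obtain ⟨d, sel, hd, hcoef⟩ := ZeroOneSdpLift.exists_subfamily_coeff_le_one w
  rw [finrank_coeffSpace] at hd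
  set q : PVRow V → Fin R → Fin R → ℤ := fun j a b => ZeroOneSdpLift.roundZ 2 R (U j a b) with hq
  set Ubar : PVRow V → Matrix (Fin R) (Fin R) ℝ :=
    fun j a b => (q j a b : ℝ) * ZeroOneSdpLift.gridStep 2 R with hUbar
  have hUerr : ∀ j a b, |(U j - Ubar j) a b| ≤ ZeroOneSdpLift.gridStep 2 R / 2 := fun j a b => by
    rw [Matrix.sub_apply]; exact ZeroOneSdpLift.abs_sub_roundZ_mul hR (U j a b)
  have hqle : ∀ j a b, |q j a b| ≤ (entryBound N R : ℤ) := fun j a b =>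
    abs_roundZ_le ((hU j).2 a b)
  have htrerr : ∀ j (Y : Matrix (Fin R) (Fin R) ℝ), (∀ a b, |Y a b| ≤ 1) →
      |(Y * (U j - Ubar j)).trace| ≤ ZeroOneSdpLift.tol 2 R := fun j Y hY => by
    rw [← sq_mul_half_gridStep hR]; exact abs_trace_mul_le hY (hUerr j)
  obtain ⟨z₀, hz₀⟩ := hV
  let row : Fin d → RowCode N R := fun t => encodeRow (sel t).1 (q (sel t))
  let row₀ : RowCode N R := encodeRow (Sum.inr (0, true)) (fun _ _ => 0)
  let c : Code N R := (⟨d, by omega⟩, fun t => if ht : (t : ℕ) < d then row ⟨t, ht⟩ else row₀)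
  have hrow_fst : ∀ t, (row t).1 = (sel t).1 := fun t => rfl
  have hrow_mat : ∀ t, (row t).mat = Ubar (sel t) := fun t => by
    rw [show row t = encodeRow (sel t).1 (q (sel t)) from rfl, encodeRow_mat _ (hqle (sel t))]
  have hc2 : ∀ (t : ℕ) (ht : t < d), c.2 ⟨t, lt_of_lt_of_le ht hd⟩ = row ⟨t, ht⟩ := fun t ht => by
    simp [c, dif_pos ht]
  have htest : ∀ (t : Fin d) (z : Fin N) (Y : Matrix (Fin R) (Fin R) ℝ),
      testVal (row t) z Y =
        (prhs (sel t).1 - pvec (sel t).1 ⬝ᵥ pt z - (Y * U (sel t)).trace)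
          + (Y * (U (sel t) - Ubar (sel t))).trace := by
    intro t z Y
    rw [testVal, hrow_fst, hrow_mat, Matrix.mul_sub, Matrix.trace_sub]
    ring
  refine ⟨c, ?_⟩
  ext z
  rw [mem_decode]
  constructor
  · rintro ⟨Y, hYadm, hYtest⟩
    by_contra hz
    obtain ⟨ρ, hρ, hviol⟩ := exists_valid_violated ⟨z₀, hz₀⟩ hz
    set j : PVRow V := ⟨Sum.inl ρ, hρ⟩ with hj
    obtain ⟨ν, hν, hwj⟩ := hcoef j
    have h1 : pvec j.1 = ∑ t, ν t • pvec (sel t).1 := by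
      have := congrArg Prod.fst hwj
      simpa [hw, Prod.fst_sum] using this
    have h2 : prhs j.1 = ∑ t, ν t * prhs (sel t).1 := by
      have := congrArg (fun p => p.2.1) hwj
      simpa [hw, Prod.snd_sum, Prod.fst_sum] using this
    have h3 : U j = ∑ t, ν t • U (sel t) := by
      have := congrArg (fun p => p.2.2) hwj
      simpa [hw, Prod.snd_sum] using this
    set S : Fin d → ℝ := fun t =>
      prhs (sel t).1 - pvec (sel t).1 ⬝ᵥ pt z - (Y * U (sel t)).trace with hS
    have hcomb : prhs j.1 - pvec j.1 ⬝ᵥ pt z - (Y * U j).trace = ∑ t, ν t * S t := by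
      rw [h1, h2, h3, sum_smul_dotProduct, trace_mul_sum_smul, ← Finset.sum_sub_distrib,
        ← Finset.sum_sub_distrib]
      refine Finset.sum_congr rfl fun t _ => ?_
      rw [hS]; ring
    have hneg : prhs j.1 - pvec j.1 ⬝ᵥ pt z ≤ -1 := by
      show dval ρ - cvec ρ ⬝ᵥ pt z ≤ -1
      rw [slack_eq]; exact_mod_cast hviol
    have htr : 0 ≤ (Y * U j).trace := trace_mul_nonneg hYadm.1 (hU j).1
    have hone : 1 ≤ ∑ t, |S t| := by
      have hle : ∑ t, ν t * S t ≤ -1 := by rw [← hcomb]; linarith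
      calc (1 : ℝ) ≤ |∑ t, ν t * S t| := by
            rw [abs_of_nonpos (by linarith)]; linarith
        _ ≤ ∑ t, |ν t * S t| := abs_sum_le_sum_abs _ _
        _ ≤ ∑ t, |S t| := sum_le_sum fun t _ => by
            rw [abs_mul]
            exact mul_le_of_le_one_left (abs_nonneg _) (hν t)
    have hdpos : 0 < d := by
      by_contra hd0
      have hd0' : d = 0 := by omega
      subst hd0'
      rw [Fintype.sum_empty] at hone
      linarith
    have hDpos : (0 : ℝ) < ZeroOneSdpLift.dimBound 2 R := by exact_mod_cast dimBound_pos R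
    obtain ⟨t, -, ht⟩ : ∃ t ∈ (univ : Finset (Fin d)),
        1 / (ZeroOneSdpLift.dimBound 2 R : ℝ) ≤ |S t| := by
      apply Finset.exists_le_of_sum_le (univ_nonempty_iff.2 ⟨⟨0, hdpos⟩⟩)
      rw [Finset.sum_const, Finset.card_univ, Fintype.card_fin, nsmul_eq_mul, mul_one_div]
      calc (d : ℝ) / ZeroOneSdpLift.dimBound 2 R ≤ 1 := by
            rw [div_le_one hDpos]; exact_mod_cast hd
        _ ≤ ∑ t, |S t| := hone
    have hYt := hYtest ⟨t, lt_of_lt_of_le t.2 hd⟩ t.2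
    rw [hc2 t t.2, Fin.eta, htest t z Y] at hYt
    have herr := htrerr (sel t) Y hYadm.2
    have hSle : |S t| ≤ ZeroOneSdpLift.tol 2 R + ZeroOneSdpLift.tol 2 R := by
      have := abs_add_le (S t + (Y * (U (sel t) - Ubar (sel t))).trace)
        (-(Y * (U (sel t) - Ubar (sel t))).trace)
      rw [add_neg_cancel_right, abs_neg] at this
      linarith
    have htol4 : ZeroOneSdpLift.tol 2 R = (1 / (ZeroOneSdpLift.dimBound 2 R : ℝ)) / 4 := by
      rw [ZeroOneSdpLift.tol]; ring
    have hpos : 0 < 1 / (ZeroOneSdpLift.dimBound 2 R : ℝ) := by positivity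
    rw [htol4] at hSle
    linarith
  · intro hz
    refine ⟨X ⟨z, hz⟩, ⟨(hX _).1, (hX _).2⟩, fun t ht => ?_⟩
    have ht' : (t : ℕ) < d := by simpa [c] using ht
    have hct : c.2 t = row ⟨t, ht'⟩ := by
      have := hc2 t ht'; simpa using this
    rw [hct, htest, ← hXU ⟨z, hz⟩ (sel ⟨t, ht'⟩), sub_self, zero_add]
    exact htrerr _ _ (hX _).2

/-! ### P8. Counting -/

/-- If every `n`-subset of the `2n` grid points spans a polygon with a psd lift of size `R ≥ 1`,
decoding hits every `n`-subset: `C(2n, n) ≤ #codes`. [cite: BrietDadushPokutta2014, Thm. 8 proof (§5, p12: "the above set of polygons map to in an injective manner")] -/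
theorem choose_le_card_code {n R : ℕ} (hn : 1 ≤ n) (hR : 1 ≤ R)
    (hall : ∀ V : Finset (Fin (2 * n)), V.card = n →
      HasPsdLift (convexHull ℝ (pt '' (V : Set (Fin (2 * n))))) R) :
    (2 * n).choose n ≤ Fintype.card (Code (2 * n) R) := by
  classical
  set 𝓕 := (Finset.univ : Finset (Fin (2 * n))).powersetCard n with h𝓕def
  have h𝓕 : 𝓕.card = (2 * n).choose n := by
    rw [h𝓕def, Finset.card_powersetCard, Finset.card_univ, Fintype.card_fin]
  have hsub : 𝓕 ⊆ (Finset.univ : Finset (Code (2 * n) R)).image decode := fun V hV => by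
    have hcard : V.card = n := (Finset.mem_powersetCard.1 hV).2
    have hne : V.Nonempty := by rw [← Finset.card_pos, hcard]; exact hn
    obtain ⟨c, hc⟩ := exists_code_decode_eq hne hR (hall V hcard)
    exact Finset.mem_image.2 ⟨c, Finset.mem_univ _, hc⟩
  calc (2 * n).choose n = 𝓕.card := h𝓕.symm
    _ ≤ ((Finset.univ : Finset (Code (2 * n) R)).image decode).card := Finset.card_le_card hsub
    _ ≤ (Finset.univ : Finset (Code (2 * n) R)).card := Finset.card_image_le
    _ = Fintype.card (Code (2 * n) R) := Finset.card_univ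

/-- The number of codes is at most `2^{130 ⌊log₂ n⌋ R⁴}` (`N = 2n`, `n ≥ 2`, `1 ≤ R ≤ n`; printed:
"`(cd^{14})^{(3+R²)²} ≤ 2^{c' · R⁴ · log d}`"). [cite: BrietDadushPokutta2014, Thm. 8 proof (§5, p12)] -/
theorem card_code_le_two_pow {n R : ℕ} (hn : 2 ≤ n) (hR : 1 ≤ R) (hRn : R ≤ n) :
    Fintype.card (Code (2 * n) R) ≤ 2 ^ (130 * Nat.log 2 n * R ^ 4) := by
  rw [card_code]
  set L := Nat.log 2 n with hL
  have hL1 : 1 ≤ L := Nat.log_pos one_lt_two hn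
  have hnL : n < 2 ^ (L + 1) := Nat.lt_pow_succ_log_self one_lt_two n
  set M := 2 ^ (L + 1) with hM
  have hnM : n ≤ M := hnL.le
  have hD : ZeroOneSdpLift.dimBound 2 R = R ^ 2 + 3 := by unfold ZeroOneSdpLift.dimBound; ring
  have hG : ZeroOneSdpLift.gridInv 2 R = 2 * R ^ 2 * (R ^ 2 + 3) := by
    unfold ZeroOneSdpLift.gridInv ZeroOneSdpLift.dimBound; ring
  have hM2 : M * M = 2 ^ (2 * L + 2) := by rw [hM, ← pow_add]; ring_nf
  have hR2 : 1 ≤ R ^ 2 := Nat.one_le_pow _ _ hR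
  have hRn2 : R ^ 2 ≤ n * n := by nlinarith
  -- the `2N² + 4` rows
  have hrow : 2 * n * (2 * n * 2) + 2 * 2 ≤ 2 ^ (8 * L) := by
    have h4 : 4 ≤ 4 * (n * n) := by nlinarith
    calc 2 * n * (2 * n * 2) + 2 * 2 = 8 * (n * n) + 4 := by ring
      _ ≤ 12 * (n * n) := by omega
      _ ≤ 16 * (M * M) := by nlinarith [Nat.mul_le_mul hnM hnM]
      _ = 2 ^ (2 * L + 6) := by
          rw [hM2, show (16 : ℕ) = 2 ^ 4 by norm_num, ← pow_add]; ring_nf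
      _ ≤ 2 ^ (8 * L) := Nat.pow_le_pow_right (by norm_num) (by omega)
  -- the rounded entries
  have hE : 2 * entryBound (2 * n) R + 1 ≤ 2 ^ (23 * L) := by
    have h1 : entryBound (2 * n) R = (2 * n) ^ 2 * R ^ 2 * (2 * R ^ 2 * (R ^ 2 + 3)) := by
      rw [entryBound, hG]
    have h3 : 2 * entryBound (2 * n) R ≤ 64 * ((n * n) * (n * n)) * ((n * n) * (n * n)) := by
      rw [h1]
      have h5 : R ^ 2 + 3 ≤ 4 * (n * n) := by nlinarith
      calc 2 * ((2 * n) ^ 2 * R ^ 2 * (2 * R ^ 2 * (R ^ 2 + 3)))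
          = 16 * (n * n) * R ^ 2 * R ^ 2 * (R ^ 2 + 3) := by ring
        _ ≤ 16 * (n * n) * (n * n) * (n * n) * (4 * (n * n)) := by gcongr
        _ = 64 * ((n * n) * (n * n)) * ((n * n) * (n * n)) := by ring
    have hMM : n * n ≤ M * M := Nat.mul_le_mul hnM hnM
    have h4 : ((n * n) * (n * n)) * ((n * n) * (n * n)) ≤ ((M * M) * (M * M)) * ((M * M) * (M * M)) :=
      Nat.mul_le_mul (Nat.mul_le_mul hMM hMM) (Nat.mul_le_mul hMM hMM)
    have h5 : ((M * M) * (M * M)) * ((M * M) * (M * M)) = 2 ^ (8 * L + 8) := by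
      rw [hM2, ← pow_add, ← pow_add]; ring_nf
    have h6 : 1 ≤ 2 ^ (8 * L + 8) := Nat.one_le_two_pow
    calc 2 * entryBound (2 * n) R + 1
        ≤ 64 * (((M * M) * (M * M)) * ((M * M) * (M * M))) + 2 ^ (8 * L + 8) := by
          have := Nat.mul_le_mul_left 64 h4
          have h7 : 64 * ((n * n) * (n * n)) * ((n * n) * (n * n))
              = 64 * (((n * n) * (n * n)) * ((n * n) * (n * n))) := by ring
          omega
      _ = 65 * 2 ^ (8 * L + 8) := by rw [h5]; ring
      _ ≤ 2 ^ 7 * 2 ^ (8 * L + 8) := Nat.mul_le_mul_right _ (by norm_num)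
      _ = 2 ^ (8 * L + 15) := by rw [← pow_add]; ring_nf
      _ ≤ 2 ^ (23 * L) := Nat.pow_le_pow_right (by norm_num) (by omega)
  have hinner : (2 * n * (2 * n * 2) + 2 * 2) * (2 * entryBound (2 * n) R + 1) ^ (R * R)
      ≤ 2 ^ (31 * L * R ^ 2) := by
    calc (2 * n * (2 * n * 2) + 2 * 2) * (2 * entryBound (2 * n) R + 1) ^ (R * R)
        ≤ 2 ^ (8 * L) * (2 ^ (23 * L)) ^ (R * R) := Nat.mul_le_mul hrow (Nat.pow_le_pow_left hE _)
      _ = 2 ^ (8 * L + 23 * L * (R * R)) := by rw [← pow_mul, ← pow_add]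
      _ ≤ 2 ^ (31 * L * R ^ 2) := Nat.pow_le_pow_right (by norm_num) (by
          rw [sq]
          have : 8 * L ≤ 8 * L * (R * R) := Nat.le_mul_of_pos_right _ (Nat.mul_pos hR hR)
          nlinarith)
  have hpowD : ((2 * n * (2 * n * 2) + 2 * 2) * (2 * entryBound (2 * n) R + 1) ^ (R * R)) ^
        ZeroOneSdpLift.dimBound 2 R ≤ 2 ^ (124 * L * R ^ 4) := by
    calc ((2 * n * (2 * n * 2) + 2 * 2) * (2 * entryBound (2 * n) R + 1) ^ (R * R)) ^
          ZeroOneSdpLift.dimBound 2 R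
        ≤ (2 ^ (31 * L * R ^ 2)) ^ ZeroOneSdpLift.dimBound 2 R := Nat.pow_le_pow_left hinner _
      _ = 2 ^ (31 * L * R ^ 2 * (R ^ 2 + 3)) := by rw [← pow_mul, hD]
      _ ≤ 2 ^ (124 * L * R ^ 4) := Nat.pow_le_pow_right (by norm_num) (by
          have h3 : L * R ^ 2 ≤ L * R ^ 4 :=
            Nat.mul_le_mul_left _ (Nat.pow_le_pow_right hR (by norm_num))
          have h4 : R ^ 2 * R ^ 2 = R ^ 4 := by ring
          calc 31 * L * R ^ 2 * (R ^ 2 + 3) = 31 * (L * R ^ 4) + 93 * (L * R ^ 2) := by ring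
            _ ≤ 31 * (L * R ^ 4) + 93 * (L * R ^ 4) := by omega
            _ = 124 * L * R ^ 4 := by ring)
  have hD1 : ZeroOneSdpLift.dimBound 2 R + 1 ≤ 2 ^ (5 * L * R ^ 4) := by
    rw [hD]
    have hR4 : R ^ 2 ≤ R ^ 4 := Nat.pow_le_pow_right hR (by norm_num)
    calc R ^ 2 + 3 + 1 ≤ 2 ^ (R ^ 2 + 3 + 1) := (Nat.lt_two_pow_self).le
      _ ≤ 2 ^ (5 * L * R ^ 4) := Nat.pow_le_pow_right (by norm_num) (by nlinarith)
  calc (ZeroOneSdpLift.dimBound 2 R + 1) *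
        ((2 * n * (2 * n * 2) + 2 * 2) * (2 * entryBound (2 * n) R + 1) ^ (R * R)) ^
          ZeroOneSdpLift.dimBound 2 R
      ≤ 2 ^ (5 * L * R ^ 4) * 2 ^ (124 * L * R ^ 4) := Nat.mul_le_mul hD1 hpowD
    _ = 2 ^ (129 * L * R ^ 4) := by rw [← pow_add]; ring_nf
    _ ≤ 2 ^ (130 * L * R ^ 4) := Nat.pow_le_pow_right (by norm_num)
        (Nat.mul_le_mul_right _ (by omega))

/-- **Counting.** If every `n`-subset of the `2n` grid points spans a polygon with a psd lift of size
`R` (`n ≥ 2`, `1 ≤ R ≤ n`) then `n ≤ 67 ⌊log₂ n⌋ R⁴` (printed: "`2^d ≤ (cd^{14})^{(3+R²)²} ≤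
2^{c' · R⁴ · log d}`", here from `C(2n, n) ≥ 4ⁿ/(2n)` subsets). [cite: BrietDadushPokutta2014, Thm. 8 proof (§5, p12)] -/
theorem le_log_mul_pow_four_of_forall {n R : ℕ} (hn : 2 ≤ n) (hR : 1 ≤ R) (hRn : R ≤ n)
    (hall : ∀ V : Finset (Fin (2 * n)), V.card = n →
      HasPsdLift (convexHull ℝ (pt '' (V : Set (Fin (2 * n))))) R) :
    n ≤ 67 * Nat.log 2 n * R ^ 4 := by
  set L := Nat.log 2 n with hL
  have hL1 : 1 ≤ L := Nat.log_pos one_lt_two hn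
  have hnL : n < 2 ^ (L + 1) := Nat.lt_pow_succ_log_self one_lt_two n
  have h4 : 4 ^ n ≤ 2 * n * (2 * n).choose n := by
    rw [← Nat.centralBinom_eq_two_mul_choose]
    exact Nat.four_pow_le_two_mul_self_mul_centralBinom n (by omega)
  have hcount := (choose_le_card_code (by omega) hR hall).trans (card_code_le_two_pow hn hR hRn)
  have h2n : 2 * n ≤ 2 ^ (L + 2) := by rw [pow_succ]; omega
  have : 2 ^ (2 * n) ≤ 2 ^ (L + 2 + 130 * L * R ^ 4) := by
    calc 2 ^ (2 * n) = 4 ^ n := by rw [pow_mul]; norm_num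
      _ ≤ 2 * n * (2 * n).choose n := h4
      _ ≤ 2 ^ (L + 2) * 2 ^ (130 * L * R ^ 4) := Nat.mul_le_mul h2n hcount
      _ = 2 ^ (L + 2 + 130 * L * R ^ 4) := by rw [← pow_add]
  have h := (Nat.pow_le_pow_iff_right (by norm_num : 1 < 2)).1 this
  have hLR : L ≤ L * R ^ 4 := Nat.le_mul_of_pos_right _ (by positivity)
  have key : 2 * n ≤ 133 * (L * R ^ 4) := by nlinarith
  calc n ≤ 67 * (L * R ^ 4) := by omega
    _ = 67 * L * R ^ 4 := by ring

/-- **Existence of an `n`-subset without small psd lifts.** If `n ≥ 2`, `1 ≤ R ≤ n` and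
`67 ⌊log₂ n⌋ R⁴ < n`, some `n`-subset of the grid spans a polygon with NO psd lift of any size
`1 ≤ k ≤ R`. [cite: BrietDadushPokutta2014, Thm. 8 proof (§5, p12)] -/
theorem exists_forall_not_hasPsdLift {n R : ℕ} (hn : 2 ≤ n) (hR : 1 ≤ R) (hRn : R ≤ n)
    (hlt : 67 * Nat.log 2 n * R ^ 4 < n) :
    ∃ V : Finset (Fin (2 * n)), V.card = n ∧
      ∀ k, 1 ≤ k → k ≤ R → ¬ HasPsdLift (convexHull ℝ (pt '' (V : Set (Fin (2 * n))))) k := by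
  by_contra hcon
  push Not at hcon
  have hall : ∀ V : Finset (Fin (2 * n)), V.card = n →
      HasPsdLift (convexHull ℝ (pt '' (V : Set (Fin (2 * n))))) R := fun V hV => by
    obtain ⟨k, -, hk, h⟩ := hcon V hV
    exact h.mono hk
  exact absurd (le_log_mul_pow_four_of_forall hn hR hRn hall) (not_le.2 hlt)

/-- A set with two distinct points has no psd lift of size `0` (`S^0` is a point). [folklore] -/
private theorem not_hasPsdLift_zero {C : Set (Fin 2 → ℝ)} {p q : Fin 2 → ℝ} (hp : p ∈ C) (hq : q ∈ C)
    (hpq : p ≠ q) : ¬ HasPsdLift C 0 := by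
  rintro ⟨L, π, hC⟩
  have hs : (π '' {M : Matrix (Fin 0) (Fin 0) ℝ | M.PosSemidef ∧ M ∈ L}).Subsingleton :=
    Set.subsingleton_of_subsingleton.image π
  rw [← hC] at hs
  exact hpq (hs hp hq)

/-- **Briët–Dadush–Pokutta, Theorem 8 — explicit `log₂` form.** For every `n ≥ 2` some `n`-subset
`V` of the grid `{(z, z²) : z ∈ [2n]}` spans a convex `n`-gon ALL of whose psd lifts have size `k`
with `n ≤ 67 · ⌊log₂ n⌋ · k⁴`, i.e. `k ≥ (n / (67 log₂ n))^{1/4}`. [cite: BrietDadushPokutta2014, Thm. 8 (§5, p12)] -/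
theorem exists_ngon_le_log_mul_pow_four {n : ℕ} (hn : 2 ≤ n) :
    ∃ V : Finset (Fin (2 * n)), V.card = n ∧
      ∀ k : ℕ, HasPsdLift (convexHull ℝ (pt '' (V : Set (Fin (2 * n))))) k →
        n ≤ 67 * Nat.log 2 n * k ^ 4 := by
  classical
  set L := Nat.log 2 n with hL
  have hL1 : 1 ≤ L := Nat.log_pos one_lt_two hn
  have hk0 : ∀ V : Finset (Fin (2 * n)), V.card = n → ∀ k,
      HasPsdLift (convexHull ℝ (pt '' (V : Set (Fin (2 * n))))) k → 1 ≤ k := by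
    intro V hV k hk
    by_contra h0
    have hk' : k = 0 := by omega
    subst hk'
    have h1 : 1 < V.card := by omega
    obtain ⟨a, ha, b, hb, hab⟩ := Finset.one_lt_card.1 h1
    exact not_hasPsdLift_zero (C := convexHull ℝ (pt '' (V : Set (Fin (2 * n)))))
      (subset_convexHull ℝ _ ⟨a, ha, rfl⟩) (subset_convexHull ℝ _ ⟨b, hb, rfl⟩)
      (fun h => hab (pt_injective h)) hk
  set P : ℕ → Prop := fun R => 67 * L * R ^ 4 < n with hP
  by_cases hP1 : P 1
  · set R₀ := Nat.findGreatest P n with hR₀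
    have h1R₀ : 1 ≤ R₀ := Nat.le_findGreatest (by omega) hP1
    have hR₀n : R₀ ≤ n := Nat.findGreatest_le n
    have hPR₀ : P R₀ := Nat.findGreatest_spec (P := P) (show 1 ≤ n by omega) hP1
    obtain ⟨V, hV, hnot⟩ := exists_forall_not_hasPsdLift hn h1R₀ hR₀n hPR₀
    refine ⟨V, hV, fun k hk => ?_⟩
    have hk1 := hk0 V hV k hk
    have hkR : R₀ < k := by
      by_contra hle
      exact hnot k hk1 (not_lt.1 hle) hk
    by_cases hkn : k ≤ n
    · exact not_lt.1 (Nat.findGreatest_is_greatest (P := P) hkR hkn)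
    · have h1 : n ≤ k ^ 4 := by
        calc n ≤ k := by omega
          _ = k ^ 1 := (pow_one k).symm
          _ ≤ k ^ 4 := Nat.pow_le_pow_right hk1 (by norm_num)
      calc n ≤ k ^ 4 := h1
        _ = 1 * 1 * k ^ 4 := by ring
        _ ≤ 67 * L * k ^ 4 := by gcongr; omega
  · have hPn : n ≤ 67 * L := by
      have : ¬ 67 * L * 1 ^ 4 < n := hP1
      simpa using this
    obtain ⟨V, -, hV⟩ : ∃ V : Finset (Fin (2 * n)), V ⊆ Finset.univ ∧ V.card = n :=
      Finset.exists_subset_card_eq (by simp; omega)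
    refine ⟨V, hV, fun k hk => ?_⟩
    have h1 := hk0 V hV k hk
    calc n ≤ 67 * L := hPn
      _ = 67 * L * 1 ^ 4 := by ring
      _ ≤ 67 * L * k ^ 4 := by gcongr

end IntegralPolygonPsd

open IntegralPolygonXC IntegralPolygonPsd in
/-- **Briët–Dadush–Pokutta 2015, Theorem 8** (Math. Program. 153 (2015) 179–199 = arXiv:1305.3268,
§5 p12, verbatim): "For every `d ≥ 3`, there exists a `d`-gon `P` with vertices in `[2d] × [4d²]`
and `xc_SDP(P) = Ω((d/log d)^{1/4})`."  Here `xc_SDP(K)` is the least size `r` of a semidefinite EF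
(their Def. 1), for polytopes the psd rank of a slack matrix (their Thm. 1) and the least size of a
psd lift `K = π(S^r_+ ∩ L)` (FGPRT eq. (3) / Thm. 3.3, the tree's `HasPsdLift`, the reading used for
the companion `BrietDadushPokutta2014_thm7`); `Ω` read as `∃ c > 0 ∃ n₀ ∀ n ≥ n₀`; the `n`-gon is an
injective family of `n` points `(z, z²)`, `z ∈ [2n]`, in convex position. PROVED (`c = 1/4`,
`n₀ = 2`) from `IntegralPolygonPsd.exists_ngon_le_log_mul_pow_four` (`n ≤ 67 ⌊log₂ n⌋ k⁴`).
[cite: BrietDadushPokutta2014, Thm. 8 and Lemma 3 (§5, p12)] -/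
theorem BrietDadushPokutta2014_thm8 :
    ∃ c : ℝ, 0 < c ∧ ∃ n₀ : ℕ, ∀ n : ℕ, n₀ ≤ n →
      ∃ x : Fin n → (Fin 2 → ℝ),
        (∀ i, ∃ z : ℕ, 1 ≤ z ∧ z ≤ 2 * n ∧ x i = ![(z : ℝ), (z : ℝ) ^ 2]) ∧
        Function.Injective x ∧
        (∀ i, x i ∈ (convexHull ℝ (Set.range x)).extremePoints ℝ) ∧
        ∀ r : ℕ, HasPsdLift (convexHull ℝ (Set.range x)) r →
          c * ((n : ℝ) / Real.log n) ^ (1 / 4 : ℝ) ≤ r := by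
  classical
  refine ⟨1 / 4, by norm_num, 2, fun n hn => ?_⟩
  obtain ⟨V, hV, hVk⟩ := exists_ngon_le_log_mul_pow_four hn
  set e := V.orderEmbOfFin hV with he
  have hrange : Set.range (fun i => pt (e i)) = pt '' (V : Set (Fin (2 * n))) := by
    rw [show (fun i => pt (e i)) = pt ∘ e from rfl, Set.range_comp, Finset.range_orderEmbOfFin]
  refine ⟨fun i => pt (e i), fun i => ?_, pt_injective.comp e.injective,
    pt_mem_extremePoints e e.injective, fun r hr => ?_⟩
  · refine ⟨(e i : ℕ) + 1, by omega, by have := (e i).2; omega, ?_⟩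
    simp only [pt, absc]
    push_cast
    rfl
  rw [hrange] at hr
  have hnat := hVk r hr
  set L := Nat.log 2 n with hL
  have hn1 : (1 : ℝ) < n := by exact_mod_cast (show 1 < n by omega)
  have hlogn : 0 < Real.log n := Real.log_pos hn1
  have hlog2 : (0.6931471803 : ℝ) < Real.log 2 := Real.log_two_gt_d9
  have hlog2pos : 0 < Real.log 2 := by linarith
  have hLlog : (L : ℝ) * Real.log 2 ≤ Real.log n := by
    have h := Nat.pow_log_le_self 2 (show n ≠ 0 by omega)
    have h' : ((2 : ℝ) ^ L) ≤ n := by exact_mod_cast h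
    calc (L : ℝ) * Real.log 2 = Real.log ((2 : ℝ) ^ L) := by rw [Real.log_pow]
      _ ≤ Real.log n := Real.log_le_log (by positivity) h'
  have hreal : (n : ℝ) ≤ 67 * L * (r : ℝ) ^ 4 := by exact_mod_cast hnat
  have h1 : (n : ℝ) * Real.log 2 ≤ 67 * Real.log n * (r : ℝ) ^ 4 := by
    calc (n : ℝ) * Real.log 2 ≤ 67 * L * (r : ℝ) ^ 4 * Real.log 2 := by gcongr
      _ = 67 * ((L : ℝ) * Real.log 2) * (r : ℝ) ^ 4 := by ring
      _ ≤ 67 * Real.log n * (r : ℝ) ^ 4 := by gcongr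
  have hr0 : (0 : ℝ) ≤ r := Nat.cast_nonneg r
  have hX : 0 ≤ (r : ℝ) ^ 4 * Real.log n := mul_nonneg (by positivity) hlogn.le
  have h2 : (n : ℝ) / Real.log n ≤ 98 * (r : ℝ) ^ 4 := by
    rw [div_le_iff₀ hlogn]
    have : (n : ℝ) * Real.log 2 ≤ (98 * (r : ℝ) ^ 4 * Real.log n) * Real.log 2 := by
      calc (n : ℝ) * Real.log 2 ≤ 67 * Real.log n * (r : ℝ) ^ 4 := h1
        _ ≤ (98 * (r : ℝ) ^ 4 * Real.log n) * Real.log 2 := by nlinarith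
    exact le_of_mul_le_mul_right this hlog2pos
  have hq0 : (0 : ℝ) ≤ n / Real.log n := div_nonneg (Nat.cast_nonneg n) hlogn.le
  have hA0 : 0 ≤ 1 / 4 * ((n : ℝ) / Real.log n) ^ (1 / 4 : ℝ) := by positivity
  rw [← pow_le_pow_iff_left₀ hA0 hr0 (by norm_num : (4 : ℕ) ≠ 0), mul_pow]
  have h4 : (((n : ℝ) / Real.log n) ^ (1 / 4 : ℝ)) ^ 4 = (n : ℝ) / Real.log n := by
    rw [show (1 / 4 : ℝ) = ((4 : ℕ) : ℝ)⁻¹ by norm_num, Real.rpow_inv_natCast_pow hq0 (by norm_num)]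
  rw [h4]
  nlinarith [h2]

/-! ## Part III — "most polygons" and the slack-matrix readings -/

namespace IntegralPolygonXC

open Literature.Barriers.PneNP in
/-- **"Most grid `n`-gons need large extended formulations"** — the quantitative content of the
count: a family of `n`-subsets of the `2n` grid points all of whose polygons have an EF of size `R`
(`n ≥ 2`, `1 ≤ R ≤ n`) has at most `2^{200 ⌊log₂ n⌋ R²}` members — out of `C(2n, n) ≥ 4ⁿ/(2n)`
(printed: "the map `Φ` must be injective and the number of such systems …").
[cite: FioriniRothvossTiwary2012, Thm. 8 proof (p09)] -/
theorem card_le_of_forall_hasEFOfSize {n R : ℕ} (hn : 2 ≤ n) (hR : 1 ≤ R) (hRn : R ≤ n)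
    (𝓕 : Finset (Finset (Fin (2 * n))))
    (h𝓕 : ∀ V ∈ 𝓕, V.card = n ∧ HasEFOfSize (convexHull ℝ (pt '' (V : Set (Fin (2 * n))))) R) :
    𝓕.card ≤ 2 ^ (200 * Nat.log 2 n * R ^ 2) := by
  classical
  have hsub : 𝓕 ⊆ (Finset.univ : Finset (Code (2 * n) R)).image decode := fun V hV => by
    obtain ⟨hcard, hEF⟩ := h𝓕 V hV
    have hne : V.Nonempty := by rw [← Finset.card_pos, hcard]; omega
    obtain ⟨c, hc⟩ := exists_code_decode_eq hne hEF
    exact Finset.mem_image.2 ⟨c, Finset.mem_univ _, hc⟩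
  calc 𝓕.card ≤ ((Finset.univ : Finset (Code (2 * n) R)).image decode).card := Finset.card_le_card hsub
    _ ≤ (Finset.univ : Finset (Code (2 * n) R)).card := Finset.card_image_le
    _ = Fintype.card (Code (2 * n) R) := Finset.card_univ
    _ ≤ 2 ^ (200 * Nat.log 2 n * R ^ 2) := card_code_le_two_pow hn hR hRn

end IntegralPolygonXC

namespace IntegralPolygonPsd

open IntegralPolygonXC in
/-- **"Most grid `n`-gons need large psd lifts"**: a family of `n`-subsets of the `2n` grid points
all of whose polygons have a psd lift of size `R` (`n ≥ 2`, `1 ≤ R ≤ n`) has at most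
`2^{130 ⌊log₂ n⌋ R⁴}` members — out of `C(2n, n) ≥ 4ⁿ/(2n)`.
[cite: BrietDadushPokutta2014, Thm. 8 proof (§5, p12)] -/
theorem card_le_of_forall_hasPsdLift {n R : ℕ} (hn : 2 ≤ n) (hR : 1 ≤ R) (hRn : R ≤ n)
    (𝓕 : Finset (Finset (Fin (2 * n))))
    (h𝓕 : ∀ V ∈ 𝓕, V.card = n ∧ HasPsdLift (convexHull ℝ (pt '' (V : Set (Fin (2 * n))))) R) :
    𝓕.card ≤ 2 ^ (130 * Nat.log 2 n * R ^ 4) := by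
  classical
  have hsub : 𝓕 ⊆ (Finset.univ : Finset (Code (2 * n) R)).image decode := fun V hV => by
    obtain ⟨hcard, hlift⟩ := h𝓕 V hV
    have hne : V.Nonempty := by rw [← Finset.card_pos, hcard]; omega
    obtain ⟨c, hc⟩ := exists_code_decode_eq hne hR hlift
    exact Finset.mem_image.2 ⟨c, Finset.mem_univ _, hc⟩
  calc 𝓕.card ≤ ((Finset.univ : Finset (Code (2 * n) R)).image decode).card := Finset.card_le_card hsub
    _ ≤ (Finset.univ : Finset (Code (2 * n) R)).card := Finset.card_image_le
    _ = Fintype.card (Code (2 * n) R) := Finset.card_univ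
    _ ≤ 2 ^ (130 * Nat.log 2 n * R ^ 4) := card_code_le_two_pow hn hR hRn

end IntegralPolygonPsd

open Literature.Barriers.PneNP in
/-- **Theorem 8 (FRT) in slack-matrix language** (their Thm. 1, Yannakakis: "`xc(P) = rank₊(S(P))`";
the tree's `hasEFOfSize_of_complete_nonneg_factorization`): for the same polygons and EVERY
H-description `conv{x_i} = {y : a_jᵀy ≤ b_j}`, every nonnegative factorization
`b_j − a_jᵀx_i = Σ_{l<k} U_{jl} W_{il}` of the slack matrix has `k ≥ c √(n / log n)`.
[cite: FioriniRothvossTiwary2012, Thm. 8 (p09) and Thm. 1 (§2, p04)] -/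
theorem FioriniRothvossTiwary2012_thm8_nonnegRank :
    ∃ c : ℝ, 0 < c ∧ ∃ n₀ : ℕ, ∀ n : ℕ, n₀ ≤ n →
      ∃ x : Fin n → (Fin 2 → ℝ),
        (∀ i, ∃ z : ℕ, 1 ≤ z ∧ z ≤ 2 * n ∧ x i = ![(z : ℝ), (z : ℝ) ^ 2]) ∧
        Function.Injective x ∧
        (∀ i, x i ∈ (convexHull ℝ (Set.range x)).extremePoints ℝ) ∧
        ∀ (f k : ℕ) (a : Fin f → (Fin 2 → ℝ)) (b : Fin f → ℝ)
          (U : Fin f → Fin k → ℝ) (W : Fin n → Fin k → ℝ),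
          convexHull ℝ (Set.range x) = {y | ∀ j, a j ⬝ᵥ y ≤ b j} →
          (∀ j l, 0 ≤ U j l) → (∀ i l, 0 ≤ W i l) →
          (∀ j i, b j - a j ⬝ᵥ x i = ∑ l, U j l * W i l) →
          c * Real.sqrt (n / Real.log n) ≤ k := by
  obtain ⟨c, hc, n₀, h⟩ := FioriniRothvossTiwary2012_thm8
  refine ⟨c, hc, n₀, fun n hn => ?_⟩
  obtain ⟨x, h1, h2, h3, h4⟩ := h n hn
  refine ⟨x, h1, h2, h3, fun f k a b U W hdesc hU hW hfac => h4 k ?_⟩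
  have hEF := hasEFOfSize_of_complete_nonneg_factorization x a b
    (fun y hy => by rw [hdesc]; exact hy) U W hU hW hfac
  simpa only [Fintype.card_fin] using hEF

/-- **Theorem 8 (BDP) in slack-matrix language** (their Thm. 1 / FGPRT Thm. 3.3 =
`FawziEtAl2015_thm33_holds`: "the semidefinite rank of all slack matrices of `P` is identical" to
`xc_SDP(P)`): for the same polygons and EVERY H-description `conv{x_i} = {y : a_jᵀy ≤ b_j}`, every psd
factorization of the slack matrix `(b_j − a_jᵀx_i)` of size `k ≥ 1` has `k ≥ c (n / log n)^{1/4}`.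
[cite: BrietDadushPokutta2014, Thm. 8 (§5, p12); Thm. 1 (§2)] -/
theorem BrietDadushPokutta2014_thm8_slack :
    ∃ c : ℝ, 0 < c ∧ ∃ n₀ : ℕ, ∀ n : ℕ, n₀ ≤ n →
      ∃ x : Fin n → (Fin 2 → ℝ),
        (∀ i, ∃ z : ℕ, 1 ≤ z ∧ z ≤ 2 * n ∧ x i = ![(z : ℝ), (z : ℝ) ^ 2]) ∧
        Function.Injective x ∧
        (∀ i, x i ∈ (convexHull ℝ (Set.range x)).extremePoints ℝ) ∧
        ∀ (f k : ℕ) (a : Fin f → (Fin 2 → ℝ)) (b : Fin f → ℝ), 1 ≤ k →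
          convexHull ℝ (Set.range x) = {y | ∀ j, a j ⬝ᵥ y ≤ b j} →
          HasPsdFactorization (pairSlackMatrix x a b) k →
          c * ((n : ℝ) / Real.log n) ^ (1 / 4 : ℝ) ≤ k := by
  obtain ⟨c, hc, n₀, h⟩ := BrietDadushPokutta2014_thm8
  refine ⟨c, hc, n₀, fun n hn => ?_⟩
  obtain ⟨x, h1, h2, h3, h4⟩ := h n hn
  refine ⟨x, h1, h2, h3, fun f k a b hk hdesc hfac => h4 k ?_⟩
  exact (FawziEtAl2015_thm33_holds 2 n f k x a b hk hdesc).1 hfac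

end Literature.Combinatorics.Optimization

end
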